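import Mathlib
import HarnessLib
import Summits.QuantumFields.YangMills.Theses.ConvexGribovBody
import Summits.QuantumFields.YangMills.Theses.SmallCircleAnchor
import Summits.QuantumFields.YangMills.Theses.HyperbolicRegulator
import Summits.QuantumFields.YangMills.Theses.ContractibleFibre
import Summits.QuantumFields.YangMills.Theses.DirichletWindow
import Summits.QuantumFields.YangMills.Theorems.ConvexGribovBodyContinuumLegGivenGapDock
import Summits.QuantumFields.YangMills.Theorems.ConvexGribovBodyContinuumLegGivenGapThreshold
import Summits.QuantumFields.YangMills.Theorems.DirichletWindowCriticalityOfXiDiverges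
import Summits.QuantumFields.YangMills.Theorems.ConvexGribovBodyContinuumLegGivenGapStubWitness
import Summits.QuantumFields.YangMills.Theorems.ConvexGribovBodyContinuumLegGivenGapStubCritical
import Summits.QuantumFields.YangMills.Theorems.ConvexGribovBodyContinuumLegGivenGapStubLock
import Summits.QuantumFields.YangMills.Theorems.ConvexGribovBodyContinuumLegGivenGapStubLockB
import Summits.QuantumFields.YangMills.Theorems.ConvexGribovBodyContinuumLegGivenGapStubWindowOfNG
import Summits.QuantumFields.YangMills.Theorems.ConvexGribovBodyContinuumLegGivenGapStubLskBridge
import Summits.QuantumFields.YangMills.Theorems.ConvexGribovBodyContinuumLegGivenGapStubArp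
import Summits.QuantumFields.YangMills.Theorems.ConvexGribovBodyContinuumLegGivenGapStubExtract
import Summits.QuantumFields.YangMills.Theorems.ConvexGribovBodyContinuumLegGivenGapStubCltOfCscl
import Summits.QuantumFields.YangMills.Theorems.ConvexGribovBodyContinuumLegGivenGapStubAsympCS
import Summits.QuantumFields.YangMills.Theorems.ConvexGribovBodyContinuumLegGivenGapStubSmallRotation
import Summits.QuantumFields.YangMills.Theorems.ConvexGribovBodyContinuumLegGivenGapStubBddSlabDensity
import Summits.QuantumFields.YangMills.Theorems.ConvexGribovBodyContinuumLegGivenGapStubUclOfCscl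
import Summits.QuantumFields.YangMills.Theorems.ConvexGribovBodyContinuumLegGivenGapStubRotNiven
import Summits.QuantumFields.YangMills.Theorems.ConvexGribovBodyContinuumLegGivenGapStubRotHyper
import Summits.QuantumFields.YangMills.Theorems.ConvexGribovBodyContinuumLegGivenGapStubRotOfPythagorean
import Summits.QuantumFields.YangMills.Theorems.ParabolicTrajectoryContinuumLimitOnTrajectoryStubArp
import Summits.QuantumFields.YangMills.Theorems.ParabolicTrajectoryContinuumLimitOnTrajectoryUvbOfUuvb
import Summits.QuantumFields.YangMills.Theorems.ParabolicTrajectoryContinuumLimitOnTrajectorySlabRP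
import Summits.QuantumFields.YangMills.Theorems.ParabolicTrajectoryContinuumLimitOnTrajectoryStubOSLegsD_Assembly
import Summits.QuantumFields.YangMills.Theorems.ParabolicTrajectoryContinuumLimitOnTrajectoryStubOSLegsA_Lattice
import Summits.QuantumFields.YangMills.Theorems.ParabolicTrajectoryContinuumLimitOnTrajectoryStubTransl
import Summits.QuantumFields.YangMills.Theorems.LangevinControlUVOSLegsFromFemtoAndGapStubAssemblyCompactness
import Literature.Barriers.QuantumFields.UVStabilityNonUniqueness
import Literature.MathematicalPhysics.QuantumFieldTheory.MassGapFromLatticeClustering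

/-!
# Line `Sketch` — skeleton for crux `ContinuumLegGivenGap` (stmt-QuantumFields-15828), reshape 16 (history 7 → … → 15 in `Lines/Sketch.md`)

Reshape 16 (continuation lead c4, 2026-08-17T00:40Z–01:20Z): the (ROT) conjunct of `stub_uvPackage` is REPLACED by (ROT₃₄₅)
— asymptotic invariance under the SINGLE Pythagorean rotation of the `(x⁰,x¹)`-plane (`cos θ = 3/5`, `sin θ = 4/5`) —
and full (ROT) is DERIVED by the landed glue `stub_rotOfPythagorean` (p133709) ∘ (`stub_rotNiven` p133202, `stub_rotHyper`
p133520): exact axis-permutation symmetry (route ParabolicTrajectory's landed `stub_axisSymmetry`), closedness of the angle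
set from the k-uniform E0′ bound, Niven's theorem, signed permutations, Givens generation (landed `so4_generation`).

Reshape 15 (continuation lead prover-line-stmt-QuantumFields-15828-c4-0, 2026-08-16T23:30Z): the (UCL) conjunct
(k-uniform rate-free spatial clustering, route ParabolicTrajectory's E4 input) is REMOVED from `stub_uvPackage` (now 7
conjuncts (VS)(CAN)(UUVB)(ND)(PVG)(ROT)(CSCL)) and DERIVED from (CSCL) ∧ (ROT) ∧ (UUVB) ∧ (PVG) ∧ (β_k → ∞) by four
registered glue stubs — `stub_asympCS` (abstract asymptotic Cauchy–Schwarz), `stub_smallRotation` (a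
determinant-one tilt of a spatial axis into time), `stub_bddSlabDensity` (ordered-wedge density with
coordinate-bounded factors), `stub_uclOfCscl` (assembly: tilt the spatial direction into Euclidean time by a small
proper rotation, apply (CSCL) on the spans with `t`-uniform Cauchy–Schwarz norms, extend by density with the
asymptotic Cauchy–Schwarz inequality from (ARP)). See the §2 docblock "Reshape 15".


Crux (routes `ConvexGribovBody` r5 / `SmallCircleAnchor` r4 / `HyperbolicRegulator` r5 /
`ContractibleFibre.WeakCouplingContinuumLeg` r5 — four character-identical declarations, `Iff.rfl`): for every compact
simple `G` with its Borel σ-algebra, `GapHyp G → Concl G` (`GapHyp` = per-β torus clustering of all pairs of local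
gauge-invariant observables above `β₀(r)`; `Concl` = the re-typed `YangMills` existential for `G`, first conjunct
`sch.HasWeakCouplingLimit`).

## Reshape 12 (continuation lead prover-line-stmt-QuantumFields-15828-c1-0, 2026-08-16T22:40Z): the dock is PROVED

Reshapes 7–11 docked the line on the compactness socket stmt-15926 `FlowLineStateSpace.OSLimitFromUniformBounds`
(unproved, difficulty L) and on stmt-9119 `RotationRestoration`, both typed with the all-direction clustering clause
(CL) that a wave-2 worker showed UNSATISFIABLE in every massive OS theory (re-type request pending since 19:47Z; the
inherited clause had to be carried by the flagged tracking stub `stub_socketCL`). Reshape 12 replaces that dock by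
THEOREMS OF THE TREE, found while proving reshape 11's `stub_arp`:
* route ParabolicTrajectory (crux stmt-10522, line `two-orbit-synchronisation`) landed the complete one-field SOFT OS
  PACKAGING for the canonically normalised curvature functional `curvDistribution`:
  `oneFieldOSLegs' : ConvProducts → UVB → AsympEuclid → ARP → UCL → ND2 → ND3 → ∃ T, IsYangMillsFor r (canon r sch) T ∧
  T.IsNontrivial r.curvature ∧ T.IsNonGaussian r.curvature` (ultrafilter limits, Hahn–Banach, E0–E4 inheritance), and
  the approximate-RP kinematics `stub_arp : TorusSlabRP → UUVB → UVB → ARP`, `uvb_of_uuvb`, `torusSlabRP_of_tendsto`;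
* Literature `MassGapFromLatticeClustering`: `IsYangMillsFor.hasMassGap_of_hasCSClustering` reads the CONTINUUM gap
  `T.HasMassGap Δ` off the OS-currency lattice statement `sch.HasCSClustering r Δ` (exactly the repair the leads of the
  misstated stmt-8896 `GapToContinuum` recommended);
* route LangevinControlUV's compactness toolkit `exists_subseq_clm_limit` and Literature `subScheme`
  (`isYangMillsFor_subScheme_iff`, `hasLatticeMassGap_subScheme`).
With (CAN) ∧ (VS) our socket functional `LSk` IS `curvDistribution` (landed `lsk_eq_curvDistribution`, p125690), so:

`ContinuumLegGivenGap_of (hXi : DirichletWindow.XiDiverges) : ConvexGribovBody.ContinuumLegGivenGap` — ONE by-name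
lean (criticality), no socket, no `stub_socketCL`. Composition: `stub_uvPackage` picks the faithful `r`;
`stub_twoSidedCore` + landed `stub_lock_of_twoSidedCore` lock the IR data at `r`; landed `stub_critical` gives
`m̂_k → 0`; `stub_uvPackage` returns the canonical scheme `sch` with (VS)(CAN)(UUVB)(ND)(CL-t)(UCL)(EUC)(ROT)(CSCL); landed
`stub_uvb`/`stub_arp` give (UVB)/(ARP); `stub_skewWindow` + landed `stub_witness` give the skewness floor FREQUENTLY;
`stub_extract` passes to a sub-scheme `sch₂ = subScheme sch ψ` inside that frequently-set with `ConvProducts` — along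
which the floor is EVENTUAL (ND3) and every other clause is inherited; `oneFieldOSLegs'` yields `T`; the lattice gap
at rate `Δ₀` rides along `ψ` (landed `hasLatticeMassGap_of_uniformClustering`), the continuum gap at rate `Δ₁` comes
from (CSCL); both hold at `Δ = min Δ₀ Δ₁`; `β ∘ φ ∘ ψ → ∞` is `HasWeakCouplingLimit`.

Reshape 13 (22:55Z): the (EUC) conjunct of `stub_uvPackage` is DERIVED from a free geometric clause (PVG, polynomial volume
growth) by route ParabolicTrajectory's landed `stub_transl : PolyVolumeGrowth → UUVB → AsympTransl` (`euc_of_pvg`).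

Reshape 14 (continuation lead prover-line-stmt-QuantumFields-15828-c3-0, 2026-08-16T22:30Z): the (CL-t) conjunct of
`stub_uvPackage` is REMOVED from the UV stub and DERIVED from (CAN) ∧ (VS) ∧ (UUVB) ∧ (PVG) ∧ (CSCL) by the new registered
glue stub `stub_cltOfCscl` (provable: sesquilinear expansion on spans of slab-ordered real product tensors + the k-uniform
E0′ continuity from (UUVB) + ordered-wedge density; degenerate arities by the landed translation half of E1). The UV stub
now carries 8 conjuncts (VS)(CAN)(UUVB)(ND)(UCL)(PVG)(ROT)(CSCL). Examined and REJECTED for this line (see `Lines/Sketch.md`):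
docking (UCL)/(CSCL) on route ParabolicTrajectory's `TorusOSGap` (its slack-free form is unsatisfiable on a periodic torus —
thermal wrap-around against OS-null observables — and PT's landed `stub_uclOfGap` consumes exactly that form), docking on
PT's cruxes (A) stmt-10522 / (B) stmt-10523 by name ((A) carries no continuum gap and needs the (S)-class tuning input;
(B) would idle `GapHyp`), and sharing stmt-9443's registered IR stubs verbatim (its `stub_gapStability` asserts a
whole-space cylinder gap, refuted for `π₁(G) ≠ 0` by the 't Hooft twist sectors; our `stub_twoSidedCore` is stated for
LOCAL observables and evades that witness).

Stubs (3 registered + landed ones imported): `stub_twoSidedCore` (IR finite-size core; = stmt-9443's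
`stub_gapStability` ∘ `stub_thermalMultiplicity` ∘ `stub_blockDecomposition`; open), `stub_uvPackage` (UV engine; open),
`stub_skewWindow` (card K1 ∧ K2 = (NG) of tr F²; = stmt-9118 with (CL-t); open); LANDED and imported by name: `stub_cltOfCscl`
(reshape 14: (CL-t) from (CSCL) ∧ (UUVB), p129089), `stub_extract` (compactness, p126320).
Disproof.lean gen 2 (unchanged since 19:19Z) honoured: r from `IsCompactSimpleLieGroup` (§2 `_without_linear`),
non-abelianness enters through (ND)/(NG) (§2 `_without_nonabelian`), GapHyp consumed for the scale and the lattice gap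
(§2 `conclMinus_iff_seqLatticeGap`), SHARP kept in the IR datum (§3).
-/

noncomputable section

namespace Summit.QuantumFields.YangMills.Cruxes.ContinuumLegGivenGap.Sketch

open scoped SchwartzMap
open Filter Topology MeasureTheory
open Literature.MathematicalPhysics.QuantumFieldTheory Literature.MathematicalPhysics.QuantumLattice
  Literature.MathematicalPhysics.AQFT Literature.Probability.LatticeModels
open Literature.Barriers.QuantumFields (subScheme subScheme_a subScheme_β subScheme_L subScheme_side
  hasLatticeMassGap_subScheme hasWeakCouplingLimit_subScheme)
open Summit.QuantumFields.YangMills.Theorems.ContinuumLegGivenGap (hasLatticeMassGap_of_uniformClustering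
  lsk_eq_curvDistribution uuvb_of_unfolded)
open Summit.QuantumFields.YangMills.Theorems.OSLegsFromFemtoAndGap (exists_subseq_clm_limit)

open Summit.QuantumFields.YangMills.Theses
open Summit.QuantumFields.YangMills.Cruxes.ContinuumLimitOnTrajectory.TwoOrbitSynchronisation
  (curvDistribution curvNPoint canon curvCLM curvCLM_apply curvDistribution_tensor curvDistribution_sub
   ConvProducts AsympEuclid ND2 ND3 UCL oneFieldOSLegs' torusSlabRP_of_tendsto)

/-- Route ParabolicTrajectory's E0′ bound (its `UVB`, on `curvDistribution`; ours is stated on `LSk`). -/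
local notation "PT_UVB" => Summit.QuantumFields.YangMills.Cruxes.ContinuumLimitOnTrajectory.TwoOrbitSynchronisation.UVB
/-- Route ParabolicTrajectory's approximate reflection positivity (its `ARP`, on `curvDistribution`). -/
local notation "PT_ARP" => Summit.QuantumFields.YangMills.Cruxes.ContinuumLimitOnTrajectory.TwoOrbitSynchronisation.ARP
/-- Route ParabolicTrajectory's uniform plaquette-string bounds (its `UUVB`, on `canonDistribution`). -/
local notation "PT_UUVB" => Summit.QuantumFields.YangMills.Cruxes.ContinuumLimitOnTrajectory.TwoOrbitSynchronisation.UUVB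

/-! ## §0 Vocabulary (bodies over existing declarations only; stubs are stated WITHOUT these abbreviations) -/

variable {G : Type} [Group G] [TopologicalSpace G] [IsTopologicalGroup G] [CompactSpace G]
  [MeasurableSpace G] [BorelSpace G]

/-- The crux's hypothesis at one `(G, r)`: above `β₀`, at each `β` some rate `m > 0`, some volume
threshold `S₁` and per-pair constants. [folklore] -/
def GapHypAt (r : LatticeRep G) : Prop :=
  ∃ β₀ : ℝ, ∀ β : ℝ, β₀ ≤ β → ∃ m : ℝ, 0 < m ∧ ∃ S₁ : ℕ, ∀ A B : YMSpecies G, ∃ C : ℝ,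
    ∀ S n : ℕ, S₁ ≤ S → n ≤ S →
      |latticeConnectedCorr r.ρ β (2 * S + 1) A.F B.F n| ≤ C * Real.exp (-(m * n))

/-- **Locked IR data along a sequence** (output of the landed `stub_lock_of_twoSidedCore`): couplings `β_k → ∞`,
rates `m̂_k > 0`, thresholds `S₁ k`, a sharpness factor `K > 0`, (UNIFORM) one constant per pair for all `k` on the
tori `S ≥ S₁ k`, `n ≤ S`, and (SHARP) no volume-uniform clustering at rate `K m̂_k` at `β_k`. [folklore] -/
def LockedAlong (r : LatticeRep G) (β : ℕ → ℝ) (mh : ℕ → ℝ) (S₁ : ℕ → ℕ) (K : ℝ) : Prop :=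
  Tendsto β atTop atTop ∧ (∀ k, 0 < mh k) ∧ 0 < K ∧
    (∀ A B : YMSpecies G, ∃ C : ℝ, ∀ k S n : ℕ, S₁ k ≤ S → n ≤ S →
      |latticeConnectedCorr r.ρ (β k) (2 * S + 1) A.F B.F n| ≤ C * Real.exp (-(mh k * n))) ∧
    (∀ k S₀ : ℕ, ∃ A B : YMSpecies G, ∀ C : ℝ, ∃ S n : ℕ, S₀ ≤ S ∧ n ≤ S ∧
      C * Real.exp (-(K * mh k * n)) < |latticeConnectedCorr r.ρ (β k) (2 * S + 1) A.F B.F n|)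

/-- The smeared torus `n`-point functional of the renormalised curvature species at step `k`:
`∫ Σ_{x ∈ boxⁿ} F(a_k x) ∏ᵢ c_k a_k⁴ (P(τ_{xᵢ} Ũ) − m_k) dμ_{β_k, 2L_k+1}`. [folklore] -/
def LSk (r : LatticeRep G) (sch : SpeciesScheme (YMSpecies G)) (k n : ℕ)
    (F : 𝓢((Fin n → EuclideanSpace ℝ (Fin 4)), ℂ)) : ℂ :=
  ∫ U, ∑ x : Fin n → ↥(box 4 (sch.L k)), F (fun i => sch.a k • siteToE ↑(x i)) *
      ∏ i, ((sch.c r.curvature k * sch.a k ^ 4 *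
        (r.curvature.F (configShift (-↑(x i)) (torusLift (sch.side k) U)) - sch.m r.curvature k) : ℝ) : ℂ)
    ∂(wilsonMeasure (d := 4) (L := sch.side k) r.ρ (sch.β k))

/-- (VS) exact centring: `m_k` is the torus mean of the action density. [folklore] -/
def VS (r : LatticeRep G) (sch : SpeciesScheme (YMSpecies G)) : Prop :=
  ∀ k : ℕ, sch.m r.curvature k =
    ∫ U, r.curvature.F (torusLift (sch.side k) U) ∂(wilsonMeasure (d := 4) (L := sch.side k) r.ρ (sch.β k))

/-- (CAN) canonical normalisation of the curvature species: `c_k = a_k⁻⁴`. [folklore] -/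
def CAN (r : LatticeRep G) (sch : SpeciesScheme (YMSpecies G)) : Prop :=
  ∀ k : ℕ, sch.c r.curvature k = (sch.a k ^ 4)⁻¹

/-- (UUVB) uniform-threshold E0′-type bounds for all corner-PLAQUETTE strings (route ParabolicTrajectory's `UUVB`
unfolded into `plaquetteObs`/`wilsonTorusMean`). [folklore] -/
def UUVB (r : LatticeRep G) (sch : SpeciesScheme (YMSpecies G)) : Prop :=
  ∃ (s : ℕ) (α β' : ℝ), ∀ᶠ k in atTop, ∀ (p : ℕ) (q : Fin p → {q : Fin 4 × Fin 4 // q.1 < q.2})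
    (F : 𝓢((Fin p → EuclideanSpace ℝ (Fin 4)), ℂ)), IsOffDiagonal F →
    ‖∫ U : GaugeConfig 4 (sch.side k) G, ∑ x : Fin p → ↥(box 4 (sch.L k)),
        F (fun i => sch.a k • siteToE ↑(x i)) *
          ∏ i, ((plaquetteObs r.ρ 0 (q i).1.1 (q i).1.2 (configShift (-↑(x i)) (torusLift (sch.side k) U)) -
            wilsonTorusMean r.ρ (sch.β k) (sch.L k) (plaquetteObs r.ρ 0 (q i).1.1 (q i).1.2) : ℝ) : ℂ)
        ∂(wilsonMeasure (d := 4) (L := sch.side k) r.ρ (sch.β k))‖ ≤ α * (p.factorial : ℝ) ^ β' * schwartzNorm (p * s) F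

/-- (ND) the two-point floor (the `IsNontrivial` witness on the lattice). [folklore] -/
def ND (r : LatticeRep G) (sch : SpeciesScheme (YMSpecies G)) : Prop :=
  ∃ (f g : 𝓢((Fin 1 → EuclideanSpace ℝ (Fin 4)), ℂ)) (H : 𝓢((Fin (1 + 1) → EuclideanSpace ℝ (Fin 4)), ℂ)),
    IsTimeOrdered f ∧ IsTimeOrdered g ∧ IsAppendTensorOf H (osAdjoint f) g ∧
      ∃ δ : ℝ, 0 < δ ∧ ∀ᶠ k in atTop, δ ≤ ‖LSk r sch k (1 + 1) H‖

/-- (CL-t) time-axis exponential clustering of the smeared functionals, per-pair constants. [folklore] -/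
def CLt (r : LatticeRep G) (sch : SpeciesScheme (YMSpecies G)) : Prop :=
  ∃ Δ : ℝ, 0 < Δ ∧ ∀ (n m : ℕ) (F : 𝓢((Fin n → EuclideanSpace ℝ (Fin 4)), ℂ))
    (G' : 𝓢((Fin m → EuclideanSpace ℝ (Fin 4)), ℂ)), IsTimeOrdered F → IsTimeOrdered G' →
    ∃ C : ℝ, ∀ t : ℝ, 0 ≤ t → ∀ᶠ k in atTop,
      ∀ H : 𝓢((Fin (n + m) → EuclideanSpace ℝ (Fin 4)), ℂ),
        IsAppendTensorOf H (osAdjoint F) (translateMulti (EuclideanSpace.single 0 t) G') →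
          ‖LSk r sch k (n + m) H - LSk r sch k n (osAdjoint F) * LSk r sch k m G'‖ ≤ C * Real.exp (-Δ * t)

-- (UCL) k-uniform rate-free spatial clustering (E4 input): since reshape 15 this is route ParabolicTrajectory's
-- `UCL r sch` (on `curvDistribution`, which IS `LSk` under (CAN) ∧ (VS)), DERIVED by `stub_uclOfCscl`.

/-- (PVG) polynomial volume growth of the scheme (route ParabolicTrajectory's `PolyVolumeGrowth` unfolded): the physical
torus half-side dominates a power of the inverse spacing, eventually. [folklore] -/
def PVG (sch : SpeciesScheme (YMSpecies G)) : Prop :=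
  ∃ N : ℕ, 1 ≤ N ∧ ∀ᶠ k in atTop, (sch.a k)⁻¹ ≤ (sch.a k * (sch.L k : ℝ)) ^ N

/-- (EUC) asymptotic translation invariance on `⁰𝒮` (translation half of E1; DERIVED in reshape 13 from (PVG) ∧ (UUVB) by
route ParabolicTrajectory's landed `stub_transl`). [folklore] -/
def EUC (r : LatticeRep G) (sch : SpeciesScheme (YMSpecies G)) : Prop :=
  ∀ (n : ℕ) (F : 𝓢((Fin n → EuclideanSpace ℝ (Fin 4)), ℂ)), IsOffDiagonal F → ∀ a : EuclideanSpace ℝ (Fin 4),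
    Tendsto (fun k : ℕ => LSk r sch k n (translateMulti a F) - LSk r sch k n F) atTop (𝓝 0)

/-- (ROT) asymptotic restoration of proper rotations on `⁰𝒮` (rotation half of E1). [folklore] -/
def ROT (r : LatticeRep G) (sch : SpeciesScheme (YMSpecies G)) : Prop :=
  ∀ (n : ℕ) (F : 𝓢((Fin n → EuclideanSpace ℝ (Fin 4)), ℂ)), IsOffDiagonal F →
    ∀ R : EuclideanSpace ℝ (Fin 4) ≃ₗᵢ[ℝ] EuclideanSpace ℝ (Fin 4),
      LinearMap.det (R.toLinearEquiv : EuclideanSpace ℝ (Fin 4) →ₗ[ℝ] EuclideanSpace ℝ (Fin 4)) = 1 →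
        Tendsto (fun k : ℕ => LSk r sch k n (linActMulti R F) - LSk r sch k n F) atTop (𝓝 0)

/-- (CSCL) Cauchy–Schwarz clustering of the canonical scheme's lattice Schwinger functions at some rate `Δ₁ > 0`
(Literature `SpeciesScheme.HasCSClustering`). [folklore] -/
def CSCL (r : LatticeRep G) (sch : SpeciesScheme (YMSpecies G)) : Prop :=
  ∃ Δ₁ : ℝ, 0 < Δ₁ ∧ SpeciesScheme.HasCSClustering r (canon r sch) Δ₁

/-- (UVB) the E0′-type bound for `LSk` with `F`-dependent threshold (derived: landed `stub_uvb`). [folklore] -/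
def UVB (r : LatticeRep G) (sch : SpeciesScheme (YMSpecies G)) : Prop :=
  ∃ (s : ℕ) (α β : ℝ), ∀ (n : ℕ) (F : 𝓢((Fin n → EuclideanSpace ℝ (Fin 4)), ℂ)), IsOffDiagonal F →
    ∀ᶠ k in atTop, ‖LSk r sch k n F‖ ≤ α * (n.factorial : ℝ) ^ β * schwartzNorm (n * s) F

/-- (ARP) asymptotic reflection positivity in the finite-list E2 form (derived: landed `stub_arp`). [folklore] -/
def ARP (r : LatticeRep G) (sch : SpeciesScheme (YMSpecies G)) : Prop :=
  ∀ (N : ℕ) (deg : Fin N → ℕ) (F : (j : Fin N) → 𝓢((Fin (deg j) → EuclideanSpace ℝ (Fin 4)), ℂ)),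
    (∀ j, IsTimeOrdered (F j)) →
      ∀ H : (i j : Fin N) → 𝓢((Fin (deg i + deg j) → EuclideanSpace ℝ (Fin 4)), ℂ),
        (∀ i j, IsAppendTensorOf (H i j) (osAdjoint (F i)) (F j)) → ∀ ε : ℝ, 0 < ε →
          ∀ᶠ k in atTop, -ε ≤ (∑ i, ∑ j, LSk r sch k (deg i + deg j) (H i j)).re ∧
            |(∑ i, ∑ j, LSk r sch k (deg i + deg j) (H i j)).im| ≤ ε

/-- (GAP) the lattice-gap clause along the scheme. [folklore] -/
def GAP (r : LatticeRep G) (sch : SpeciesScheme (YMSpecies G)) : Prop :=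
  ∃ Δ : ℝ, 0 < Δ ∧ HasLatticeMassGap r sch Δ

/-- (NG) the skewness floor, FREQUENTLY in `k`. [folklore] -/
def NG (r : LatticeRep G) (sch : SpeciesScheme (YMSpecies G)) : Prop :=
  ∃ (f g h : 𝓢(EuclideanSpace ℝ (Fin 4), ℂ)) (F₃ : 𝓢((Fin 3 → EuclideanSpace ℝ (Fin 4)), ℂ)),
    IsTensorOf F₃ ![f, g, h] ∧ IsOffDiagonal F₃ ∧ ∃ δ : ℝ, 0 < δ ∧ ∃ᶠ k in atTop, δ ≤ ‖LSk r sch k 3 F₃‖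

/-- **The NLO skewness window** (card K1 ∧ K2), subsequential. [folklore] -/
def SkewWindow (r : LatticeRep G) (sch : SpeciesScheme (YMSpecies G)) : Prop :=
  ∃ (s₃ : ℂ) (φ : ℕ → ℕ) (f g h : ℕ → 𝓢(EuclideanSpace ℝ (Fin 4), ℂ))
    (F₃ : ℕ → 𝓢((Fin 3 → EuclideanSpace ℝ (Fin 4)), ℂ)) (w : ℕ → ℝ),
    s₃ ≠ 0 ∧ StrictMono φ ∧ (∀ j, 0 < w j) ∧ (∀ j, IsTensorOf (F₃ j) ![f j, g j, h j] ∧ IsOffDiagonal (F₃ j)) ∧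
      ∀ ε : ℝ, 0 < ε → ∀ᶠ j in atTop, ∀ᶠ k in atTop, ‖LSk r sch (φ k) 3 (F₃ j) / (w j : ℂ) - s₃‖ ≤ ε

variable (G) in
/-- The crux's conclusion at `G` (the re-typed `YangMills` existential for this gauge group). [folklore] -/
def Concl : Prop :=
  ∃ (r : LatticeRep G) (sch : SpeciesScheme (YMSpecies G)) (T : OSData (YMSpecies G) 4),
    sch.HasWeakCouplingLimit ∧ IsYangMillsFor r sch T ∧ T.IsNontrivial r.curvature ∧
      T.IsNonGaussian r.curvature ∧ ∃ Δ > 0, T.HasMassGap Δ ∧ HasLatticeMassGap r sch Δ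

/-! ## §1 Read-backs (definitional) -/

/-- The four route declarations of the shared item are one proposition. [folklore] -/
theorem smallCircleAnchor_iff :
    SmallCircleAnchor.ContinuumLegGivenGap ↔ ConvexGribovBody.ContinuumLegGivenGap := Iff.rfl

/-- (ditto, route `HyperbolicRegulator`). [folklore] -/
theorem hyperbolicRegulator_iff :
    HyperbolicRegulator.ContinuumLegGivenGap ↔ ConvexGribovBody.ContinuumLegGivenGap := Iff.rfl

/-- (ditto, route `ContractibleFibre`, decl `WeakCouplingContinuumLeg`). [folklore] -/
theorem contractibleFibre_iff :
    ContractibleFibre.WeakCouplingContinuumLeg ↔ ConvexGribovBody.ContinuumLegGivenGap := Iff.rfl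

/-- Read-back of the crux: `∀ G` compact simple, with the Borel σ-algebra, `GapHyp → Concl`. [folklore] -/
theorem crux_iff :
    ConvexGribovBody.ContinuumLegGivenGap ↔
      ∀ (G : Type) [Group G] [TopologicalSpace G] [IsTopologicalGroup G] [CompactSpace G],
        IsCompactSimpleLieGroup G →
          letI : MeasurableSpace G := borel G
          haveI : BorelSpace G := ⟨rfl⟩
          (∀ r : LatticeRep G, GapHypAt r) → Concl G :=
  Iff.rfl

/-! ## §2 Stubs (reshape 12: `theorem stub_… := by sorry`; self-contained, `:=`-free signatures; registered on stmt-QuantumFields-15828).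
LANDED and imported by name (namespace `Summit.QuantumFields.YangMills.Theorems.ContinuumLegGivenGap`): `stub_witness` (p121579),
`stub_critical` (p122334), `stub_lock_of_twoSidedCore` (p123035, with the `StubLock` helpers p121946), `stub_hodgeSelection` (p122628),
`stub_lskBridge` (p125242), `stub_windowOfNG` (p125188), `stub_arp` + `stub_uvb` (p125690), `stub_extract` (p126320). Open:
`stub_twoSidedCore` (IR), `stub_uvPackage` (UV), `stub_skewWindow` (card) — all three open-problem class (wave verdicts: blocked on
stmt-9443 / stmt-9117 / stmt-9118). -/

/-! ### Reshape 17 (continuation lead c5, 2026-08-17T01:30Z): the IR stub is REPLACED by a reflection-positivity core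

`stub_twoSidedCore` (reshapes 9–16: "every admissible rate is re-admissible at the fixed fraction `1/K₀` with
β-FREE pair constants above a β-dependent, PAIR-FREE volume threshold" — crux stmt-9443's finite-size core,
open) is REMOVED. Its role is played by `stub_rpCore` (box-dependent thresholds, `K₀ = 2`), which is PROVABLE from
reflection positivity of Wilson's action on the odd torus alone: for a bounded positive-time cylinder observable
`F` the connected time correlation `g(n) = corr_{β,2S+1}(F∘Θ, F; n)` is, for `n ≤ S` (and `S ≥ 2w(F)+6`), a value
of one of the two reflection-positive forms of the odd torus — `g(a+b) = Q_bond(F°∘τᵃ, F°∘τᵇ)`,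
`g(a+b+1) = Q_site(F°∘τᵃ, F°∘τᵇ)` (`stub_rpShift`; `F° = F − ⟨F⟩`, `τ` the unit time shift, torus translation
invariance and `τΘτ = Θ`) — and both forms are symmetric positive semi-definite (`stub_rpFormsCS`, from the tree's
`torus_rp_bond` / `torus_rp_site`). Hence `g ≥ 0` and `g` is LOG-CONVEX on `n ≤ S` (odd centres from the bond
form, even centres from the site form); the chord of `log g` between the free value `g(0) ≤ 2‖F‖∞²` and the
hypothesis' OWN bound `g(S) ≤ C' e^{-MS}` on the SAME torus gives `g(n) ≤ 2‖F‖∞² C'^{n/S} e^{-Mn} ≤ 2‖F‖∞² e^{-Mn/2}`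
once `S ≥ 2 log C'/M`; off-diagonal pairs by Cauchy–Schwarz in the same forms, arbitrary supports by a simultaneous
time translation (`stub_obsGeometry`), box-uniform thresholds by the landed pair-to-norm upgrade
(`stub_pairToNorm stub_bilinearUBP`, Banach–Steinhaus). The β-dependence of the constants has become β-dependence of
VOLUME THRESHOLDS, which the scheme's free tori absorb: `stub_lockOfRpCore` (the one-sided diagonal absorption of
the landed `stub_alongSequence` over the countably many box pairs + `exists_admissible_two_mul_sharp` +
`sharp_eventually_of_xiDiverges`) turns the RP core into the locked IR datum `LockedAlong` with `K = 4`. No transfer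
matrix, no thermal window, no infinite-volume detour (contrast Disproof §3, which located the content of the lock in
the torus thermal trace: the two reflection planes of the ODD torus make the torus correlation itself log-convex). -/

/-- `stub_rpFormsCS` — **the two reflection-positive forms of the odd torus are symmetric and positive
semi-definite, hence Cauchy–Schwarz** (reshape 17 glue; tree `torus_rp_bond` / `torus_rp_site` of
`CriticalContinuumLimit.AdmissibleGap`, symmetry from `Θ_T`- and translation-invariance of the torus Wilson state and
the lift intertwiners `gaugeTimeReflect_torusLift` / `gaugeTimeShift_torusLift`): for real bounded measurable cylinder
observables `X, Y` of `ℤ⁴` supported on links based at times `0 ≤ x₀ ≤ v` with `v + 2 ≤ S`, on the torus of side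
`2S+1` at `β ≥ 0` the bond form `Q₀(X,Y) = ∫ X(Θ Ũ) Y(Ũ)` and the site form `Q₁(X,Y) = ∫ X(Θ Ũ) Y(τ Ũ)`
(`Ũ = torusLift (2S+1) U`, `Θ = gaugeTimeReflect`, `τ = gaugeTimeShift`) satisfy `Qᵢ(X,Y)² ≤ Qᵢ(X,X) Qᵢ(Y,Y)` and
`Qᵢ(X,X) ≥ 0`. [folklore] -/

theorem stub_rpFormsCS :
    ∀ (G : Type) [Group G] [TopologicalSpace G] [IsTopologicalGroup G] [CompactSpace G]
      [MeasurableSpace G] [BorelSpace G] (r : LatticeRep G),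
      ∀ (β : ℝ), 0 ≤ β → ∀ (S v : ℕ), v + 2 ≤ S →
      ∀ (X Y : LGConfig 4 G → ℝ) (ΛX ΛY : Finset (Literature.MathematicalPhysics.QuantumLattice.ZdEdge 4)), Measurable X → Measurable Y →
      (∃ C : ℝ, ∀ U, |X U| ≤ C) → (∃ C : ℝ, ∀ U, |Y U| ≤ C) → IsCylinder X ΛX → IsCylinder Y ΛY →
      (∀ e ∈ ΛX, 0 ≤ e.1 0 ∧ e.1 0 ≤ (v : ℤ)) → (∀ e ∈ ΛY, 0 ≤ e.1 0 ∧ e.1 0 ≤ (v : ℤ)) →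
      (∫ U : GaugeConfig 4 (2 * S + 1) G, X (gaugeTimeReflect (torusLift (2 * S + 1) U)) *
          Y (torusLift (2 * S + 1) U) ∂(wilsonMeasure r.ρ β)) ^ 2 ≤
        (∫ U : GaugeConfig 4 (2 * S + 1) G, X (gaugeTimeReflect (torusLift (2 * S + 1) U)) *
          X (torusLift (2 * S + 1) U) ∂(wilsonMeasure r.ρ β)) *
        (∫ U : GaugeConfig 4 (2 * S + 1) G, Y (gaugeTimeReflect (torusLift (2 * S + 1) U)) *
          Y (torusLift (2 * S + 1) U) ∂(wilsonMeasure r.ρ β)) ∧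
      (∫ U : GaugeConfig 4 (2 * S + 1) G, X (gaugeTimeReflect (torusLift (2 * S + 1) U)) *
          Y (gaugeTimeShift (torusLift (2 * S + 1) U)) ∂(wilsonMeasure r.ρ β)) ^ 2 ≤
        (∫ U : GaugeConfig 4 (2 * S + 1) G, X (gaugeTimeReflect (torusLift (2 * S + 1) U)) *
          X (gaugeTimeShift (torusLift (2 * S + 1) U)) ∂(wilsonMeasure r.ρ β)) *
        (∫ U : GaugeConfig 4 (2 * S + 1) G, Y (gaugeTimeReflect (torusLift (2 * S + 1) U)) *
          Y (gaugeTimeShift (torusLift (2 * S + 1) U)) ∂(wilsonMeasure r.ρ β)) ∧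
      0 ≤ ∫ U : GaugeConfig 4 (2 * S + 1) G, X (gaugeTimeReflect (torusLift (2 * S + 1) U)) *
          X (torusLift (2 * S + 1) U) ∂(wilsonMeasure r.ρ β) ∧
      0 ≤ ∫ U : GaugeConfig 4 (2 * S + 1) G, X (gaugeTimeReflect (torusLift (2 * S + 1) U)) *
          X (gaugeTimeShift (torusLift (2 * S + 1) U)) ∂(wilsonMeasure r.ρ β) := by
  sorry

/-- `stub_rpShift` — **connected time correlations of reflected pairs are RP-form values of centred, shifted
observables** (reshape 17 glue; torus translation invariance `wilsonExpectation_comp_torusConfigShift`, `Θ_T`-invariance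
`wilsonExpectation_comp_timeReflect`, the lift intertwiners and `τΘτ = Θ`): for real bounded measurable `F, G'` and
`a, b : ℕ`, on the torus of side `2S+1`,
`corr(F∘Θ, G'; a+b) = ∫ (F(τᵃ Θ Ũ) − ⟨F⟩)(G'(τᵇ Ũ) − ⟨G'⟩)` and
`corr(F∘Θ, G'; a+b+1) = ∫ (F(τᵃ Θ Ũ) − ⟨F⟩)(G'(τᵇ τ Ũ) − ⟨G'⟩)` (`τᶜ = configShift (−c e₀)`, the translation
of `latticeConnectedCorr`; `⟨·⟩` the torus mean). No support hypothesis is needed. [folklore] -/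

theorem stub_rpShift :
    ∀ (G : Type) [Group G] [TopologicalSpace G] [IsTopologicalGroup G] [CompactSpace G]
      [MeasurableSpace G] [BorelSpace G] (r : LatticeRep G),
      ∀ (β : ℝ) (S : ℕ) (F G' : LGConfig 4 G → ℝ),
      Measurable F → Measurable G' → (∃ C : ℝ, ∀ U, |F U| ≤ C) → (∃ C : ℝ, ∀ U, |G' U| ≤ C) →
      ∀ a b : ℕ,
      latticeConnectedCorr r.ρ β (2 * S + 1) (F ∘ gaugeTimeReflect) G' (a + b) =
        ∫ U : GaugeConfig 4 (2 * S + 1) G,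
          (F (configShift (-(Pi.single 0 (a : ℤ))) (gaugeTimeReflect (torusLift (2 * S + 1) U))) -
              ∫ V : GaugeConfig 4 (2 * S + 1) G, F (torusLift (2 * S + 1) V) ∂(wilsonMeasure r.ρ β)) *
            (G' (configShift (-(Pi.single 0 (b : ℤ))) (torusLift (2 * S + 1) U)) -
              ∫ V : GaugeConfig 4 (2 * S + 1) G, G' (torusLift (2 * S + 1) V) ∂(wilsonMeasure r.ρ β))
          ∂(wilsonMeasure r.ρ β) ∧
      latticeConnectedCorr r.ρ β (2 * S + 1) (F ∘ gaugeTimeReflect) G' (a + b + 1) =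
        ∫ U : GaugeConfig 4 (2 * S + 1) G,
          (F (configShift (-(Pi.single 0 (a : ℤ))) (gaugeTimeReflect (torusLift (2 * S + 1) U))) -
              ∫ V : GaugeConfig 4 (2 * S + 1) G, F (torusLift (2 * S + 1) V) ∂(wilsonMeasure r.ρ β)) *
            (G' (configShift (-(Pi.single 0 (b : ℤ))) (gaugeTimeShift (torusLift (2 * S + 1) U))) -
              ∫ V : GaugeConfig 4 (2 * S + 1) G, G' (torusLift (2 * S + 1) V) ∂(wilsonMeasure r.ρ β))
          ∂(wilsonMeasure r.ρ β) := by
  sorry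

/-- `stub_obsGeometry` — **observable geometry on the torus** (reshape 17 glue, elementary): (i) connected time
correlations are invariant under a simultaneous Euclidean time translation of the pair (torus translation
invariance); (ii) translating the second observable by `m ≥ 0` units adds `m` to the separation; (iii) a time
translate and (iv) the bond time reflection of a local gauge-invariant observable (`YMSpecies`) are local
gauge-invariant observables with the translated / reflected supports (Literature `isZdGaugeInvariant_comp_configShift`;
`Θ(U^g) = (ΘU)^{g∘θ}`); (v) a time translate of a cylinder observable is a cylinder observable on the translated
support. [folklore] -/

theorem stub_obsGeometry :
    ∀ (G : Type) [Group G] [TopologicalSpace G] [IsTopologicalGroup G] [CompactSpace G]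
      [MeasurableSpace G] [BorelSpace G] (r : LatticeRep G),
      ∀ (β : ℝ),
      (∀ (A B : LGConfig 4 G → ℝ), Measurable A → Measurable B → (∃ C : ℝ, ∀ U, |A U| ≤ C) →
        (∃ C : ℝ, ∀ U, |B U| ≤ C) → ∀ (c : ℤ) (S n : ℕ),
        latticeConnectedCorr r.ρ β (2 * S + 1) (A ∘ configShift (-(Pi.single 0 c)))
            (B ∘ configShift (-(Pi.single 0 c))) n =
          latticeConnectedCorr r.ρ β (2 * S + 1) A B n) ∧
      (∀ (A B : LGConfig 4 G → ℝ), Measurable A → Measurable B → (∃ C : ℝ, ∀ U, |A U| ≤ C) →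
        (∃ C : ℝ, ∀ U, |B U| ≤ C) → ∀ (m n S : ℕ),
        latticeConnectedCorr r.ρ β (2 * S + 1) A (B ∘ configShift (-(Pi.single 0 (m : ℤ)))) n =
          latticeConnectedCorr r.ρ β (2 * S + 1) A B (n + m)) ∧
      (∀ (A : YMSpecies G) (c : ℤ), ∃ A' : YMSpecies G,
        A'.F = A.F ∘ configShift (-(Pi.single 0 c)) ∧
          A'.supp = A.supp.image (fun e => (e.1 + Pi.single 0 c, e.2))) ∧
      (∀ A : YMSpecies G, ∃ A' : YMSpecies G,
        A'.F = A.F ∘ gaugeTimeReflect ∧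
          A'.supp = A.supp.image (fun e => if e.2 = 0 then (latticeTimeReflection 4 (e.1 + Pi.single 0 1), 0)
            else (latticeTimeReflection 4 e.1, e.2))) ∧
      (∀ (F : LGConfig 4 G → ℝ) (Λ : Finset (Literature.MathematicalPhysics.QuantumLattice.ZdEdge 4)) (c : ℤ), IsCylinder F Λ →
        IsCylinder (F ∘ configShift (-(Pi.single 0 c))) (Λ.image (fun e => (e.1 + Pi.single 0 c, e.2)))) := by
  sorry

/-- `stub_rpCore` — **the reflection-positivity core at one coupling** (reshape 17, the assembly; replaces
`stub_twoSidedCore`; the statements of `stub_rpFormsCS`, `stub_rpShift`, `stub_obsGeometry` at `(G, r)` are its first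
three hypotheses, verbatim): at every `(G, r)` there are β-FREE pair constants `C A B`
(`= 2 e^{D(supp A, supp B)} ‖A‖∞ ‖B‖∞`, `D` a support offset) such that at every `β ≥ 0` every rate `M ∈ (0, 1]`
admissible on the tori `S ≥ S₀` with per-pair constants is re-admissible at rate `M/2` with the constants `C A B`
above a β- and BOX-dependent volume threshold `S₁(β, M, S₀, supp A, supp B)`. Route: the geometry puts the pair in
reflected position `(F∘Θ, G)` with positive-time cylinders `F, G` (offset `n₀` into the constant); the shift identities
+ Cauchy–Schwarz make `n ↦ corr(F∘Θ, F; n)` non-negative and log-convex on `n ≤ S` and bound the off-diagonal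
correlation by the geometric mean of the diagonal ones; the log-convex chord between `n = 0` (`≤ 2`, a priori) and
`n = S` (the hypothesis' own bound `C' e^{-MS}` on the same torus) gives `2 C'^{n/S} e^{-Mn} ≤ 2 e^{-Mn/2}` for
`S ≥ 2 log C'/M`; the landed pair-to-norm upgrade (`stub_pairToNorm stub_bilinearUBP`) makes `C'` — hence the
threshold — uniform over the sup-norm unit balls of the two boxes; bilinear rescaling (`exists_unit_smul_rescale`).
[folklore] -/

theorem stub_rpCore :
    ∀ (G : Type) [Group G] [TopologicalSpace G] [IsTopologicalGroup G] [CompactSpace G]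
      [MeasurableSpace G] [BorelSpace G] (r : LatticeRep G),
      (∀ (β : ℝ), 0 ≤ β → ∀ (S v : ℕ), v + 2 ≤ S →
      ∀ (X Y : LGConfig 4 G → ℝ) (ΛX ΛY : Finset (Literature.MathematicalPhysics.QuantumLattice.ZdEdge 4)), Measurable X → Measurable Y →
      (∃ C : ℝ, ∀ U, |X U| ≤ C) → (∃ C : ℝ, ∀ U, |Y U| ≤ C) → IsCylinder X ΛX → IsCylinder Y ΛY →
      (∀ e ∈ ΛX, 0 ≤ e.1 0 ∧ e.1 0 ≤ (v : ℤ)) → (∀ e ∈ ΛY, 0 ≤ e.1 0 ∧ e.1 0 ≤ (v : ℤ)) →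
      (∫ U : GaugeConfig 4 (2 * S + 1) G, X (gaugeTimeReflect (torusLift (2 * S + 1) U)) *
          Y (torusLift (2 * S + 1) U) ∂(wilsonMeasure r.ρ β)) ^ 2 ≤
        (∫ U : GaugeConfig 4 (2 * S + 1) G, X (gaugeTimeReflect (torusLift (2 * S + 1) U)) *
          X (torusLift (2 * S + 1) U) ∂(wilsonMeasure r.ρ β)) *
        (∫ U : GaugeConfig 4 (2 * S + 1) G, Y (gaugeTimeReflect (torusLift (2 * S + 1) U)) *
          Y (torusLift (2 * S + 1) U) ∂(wilsonMeasure r.ρ β)) ∧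
      (∫ U : GaugeConfig 4 (2 * S + 1) G, X (gaugeTimeReflect (torusLift (2 * S + 1) U)) *
          Y (gaugeTimeShift (torusLift (2 * S + 1) U)) ∂(wilsonMeasure r.ρ β)) ^ 2 ≤
        (∫ U : GaugeConfig 4 (2 * S + 1) G, X (gaugeTimeReflect (torusLift (2 * S + 1) U)) *
          X (gaugeTimeShift (torusLift (2 * S + 1) U)) ∂(wilsonMeasure r.ρ β)) *
        (∫ U : GaugeConfig 4 (2 * S + 1) G, Y (gaugeTimeReflect (torusLift (2 * S + 1) U)) *
          Y (gaugeTimeShift (torusLift (2 * S + 1) U)) ∂(wilsonMeasure r.ρ β)) ∧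
      0 ≤ ∫ U : GaugeConfig 4 (2 * S + 1) G, X (gaugeTimeReflect (torusLift (2 * S + 1) U)) *
          X (torusLift (2 * S + 1) U) ∂(wilsonMeasure r.ρ β) ∧
      0 ≤ ∫ U : GaugeConfig 4 (2 * S + 1) G, X (gaugeTimeReflect (torusLift (2 * S + 1) U)) *
          X (gaugeTimeShift (torusLift (2 * S + 1) U)) ∂(wilsonMeasure r.ρ β)) →
      (∀ (β : ℝ) (S : ℕ) (F G' : LGConfig 4 G → ℝ),
      Measurable F → Measurable G' → (∃ C : ℝ, ∀ U, |F U| ≤ C) → (∃ C : ℝ, ∀ U, |G' U| ≤ C) →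
      ∀ a b : ℕ,
      latticeConnectedCorr r.ρ β (2 * S + 1) (F ∘ gaugeTimeReflect) G' (a + b) =
        ∫ U : GaugeConfig 4 (2 * S + 1) G,
          (F (configShift (-(Pi.single 0 (a : ℤ))) (gaugeTimeReflect (torusLift (2 * S + 1) U))) -
              ∫ V : GaugeConfig 4 (2 * S + 1) G, F (torusLift (2 * S + 1) V) ∂(wilsonMeasure r.ρ β)) *
            (G' (configShift (-(Pi.single 0 (b : ℤ))) (torusLift (2 * S + 1) U)) -
              ∫ V : GaugeConfig 4 (2 * S + 1) G, G' (torusLift (2 * S + 1) V) ∂(wilsonMeasure r.ρ β))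
          ∂(wilsonMeasure r.ρ β) ∧
      latticeConnectedCorr r.ρ β (2 * S + 1) (F ∘ gaugeTimeReflect) G' (a + b + 1) =
        ∫ U : GaugeConfig 4 (2 * S + 1) G,
          (F (configShift (-(Pi.single 0 (a : ℤ))) (gaugeTimeReflect (torusLift (2 * S + 1) U))) -
              ∫ V : GaugeConfig 4 (2 * S + 1) G, F (torusLift (2 * S + 1) V) ∂(wilsonMeasure r.ρ β)) *
            (G' (configShift (-(Pi.single 0 (b : ℤ))) (gaugeTimeShift (torusLift (2 * S + 1) U))) -
              ∫ V : GaugeConfig 4 (2 * S + 1) G, G' (torusLift (2 * S + 1) V) ∂(wilsonMeasure r.ρ β))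
          ∂(wilsonMeasure r.ρ β)) →
      (∀ (β : ℝ),
      (∀ (A B : LGConfig 4 G → ℝ), Measurable A → Measurable B → (∃ C : ℝ, ∀ U, |A U| ≤ C) →
        (∃ C : ℝ, ∀ U, |B U| ≤ C) → ∀ (c : ℤ) (S n : ℕ),
        latticeConnectedCorr r.ρ β (2 * S + 1) (A ∘ configShift (-(Pi.single 0 c)))
            (B ∘ configShift (-(Pi.single 0 c))) n =
          latticeConnectedCorr r.ρ β (2 * S + 1) A B n) ∧
      (∀ (A B : LGConfig 4 G → ℝ), Measurable A → Measurable B → (∃ C : ℝ, ∀ U, |A U| ≤ C) →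
        (∃ C : ℝ, ∀ U, |B U| ≤ C) → ∀ (m n S : ℕ),
        latticeConnectedCorr r.ρ β (2 * S + 1) A (B ∘ configShift (-(Pi.single 0 (m : ℤ)))) n =
          latticeConnectedCorr r.ρ β (2 * S + 1) A B (n + m)) ∧
      (∀ (A : YMSpecies G) (c : ℤ), ∃ A' : YMSpecies G,
        A'.F = A.F ∘ configShift (-(Pi.single 0 c)) ∧
          A'.supp = A.supp.image (fun e => (e.1 + Pi.single 0 c, e.2))) ∧
      (∀ A : YMSpecies G, ∃ A' : YMSpecies G,
        A'.F = A.F ∘ gaugeTimeReflect ∧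
          A'.supp = A.supp.image (fun e => if e.2 = 0 then (latticeTimeReflection 4 (e.1 + Pi.single 0 1), 0)
            else (latticeTimeReflection 4 e.1, e.2))) ∧
      (∀ (F : LGConfig 4 G → ℝ) (Λ : Finset (Literature.MathematicalPhysics.QuantumLattice.ZdEdge 4)) (c : ℤ), IsCylinder F Λ →
        IsCylinder (F ∘ configShift (-(Pi.single 0 c))) (Λ.image (fun e => (e.1 + Pi.single 0 c, e.2))))) →
      ∃ C : YMSpecies G → YMSpecies G → ℝ,
        ∀ (β M : ℝ) (S₀ : ℕ), 0 ≤ β → 0 < M → M ≤ 1 →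
          (∀ A B : YMSpecies G, ∃ C' : ℝ, ∀ S n : ℕ, S₀ ≤ S → n ≤ S →
            |latticeConnectedCorr r.ρ β (2 * S + 1) A.F B.F n| ≤ C' * Real.exp (-(M * n))) →
          ∀ Λ₁ Λ₂ : Finset (Literature.MathematicalPhysics.QuantumLattice.ZdEdge 4), ∃ S₁ : ℕ,
            ∀ A B : YMSpecies G, A.supp = Λ₁ → B.supp = Λ₂ → ∀ S n : ℕ, S₁ ≤ S → n ≤ S →
              |latticeConnectedCorr r.ρ β (2 * S + 1) A.F B.F n| ≤ C A B * Real.exp (-(M / 2 * n)) := by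
  sorry

/-- `stub_lockOfRpCore` — **the locked IR datum from the RP core** (reshape 17 glue; replaces the landed
`stub_lock_of_twoSidedCore`, same conclusion): under `XiDiverges`, at a compact simple `(G, r)` with the crux's
per-β torus clustering above `β₀` and the RP core at `r` (β-free pair constants, half rate, β- and box-dependent
thresholds), there are `β_k → ∞`, rates `m̂_k > 0`, PAIR-FREE thresholds `S₁ k`, and `K > 0` with (UNIFORM) one
constant per pair for ALL `k` on the tori `S ≥ S₁ k`, `n ≤ S`, and (SHARP) no volume-uniform clustering at rate
`K m̂_k` at `β_k`. Route: `β_k := max β₀ β₂ 0 + k` (`β₂` from `sharp_eventually_of_xiDiverges` at rate `1`); at each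
`k` an admissible `M_k ∈ (0,1)` with `2M_k` sharp (`exists_admissible_two_mul_sharp`), `m̂_k := M_k/2`, `K := 4`;
enumerate the countably many box pairs `e : ℕ → Finset × Finset` (`exists_surjective_nat`), `S₁ k :=` the max of the
admissibility threshold at `k` and the core thresholds at `k` of the box pairs `e j`, `j ≤ k`; for a pair in box pair
`e j` the finitely many indices `k < j` are absorbed into the constant through the admissibility constants at those
`k` (`C'_k e^{-M_k n} ≤ C'_k e^{-m̂_k n}`) — the one-sided diagonal argument of the landed `stub_alongSequence`.
[folklore] -/

theorem stub_lockOfRpCore :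
    DirichletWindow.XiDiverges →
    ∀ (G : Type) [Group G] [TopologicalSpace G] [IsTopologicalGroup G] [CompactSpace G]
      [MeasurableSpace G] [BorelSpace G], IsCompactSimpleLieGroup G → ∀ r : LatticeRep G,
      (∃ β₀ : ℝ, ∀ β : ℝ, β₀ ≤ β → ∃ m : ℝ, 0 < m ∧ ∃ S₁ : ℕ, ∀ A B : YMSpecies G, ∃ C : ℝ,
        ∀ S n : ℕ, S₁ ≤ S → n ≤ S →
          |latticeConnectedCorr r.ρ β (2 * S + 1) A.F B.F n| ≤ C * Real.exp (-(m * n))) →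
      (∃ C : YMSpecies G → YMSpecies G → ℝ,
        ∀ (β M : ℝ) (S₀ : ℕ), 0 ≤ β → 0 < M → M ≤ 1 →
          (∀ A B : YMSpecies G, ∃ C' : ℝ, ∀ S n : ℕ, S₀ ≤ S → n ≤ S →
            |latticeConnectedCorr r.ρ β (2 * S + 1) A.F B.F n| ≤ C' * Real.exp (-(M * n))) →
          ∀ Λ₁ Λ₂ : Finset (Literature.MathematicalPhysics.QuantumLattice.ZdEdge 4), ∃ S₁ : ℕ,
            ∀ A B : YMSpecies G, A.supp = Λ₁ → B.supp = Λ₂ → ∀ S n : ℕ, S₁ ≤ S → n ≤ S →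
              |latticeConnectedCorr r.ρ β (2 * S + 1) A.F B.F n| ≤ C A B * Real.exp (-(M / 2 * n))) →
      ∃ (β : ℕ → ℝ) (mh : ℕ → ℝ) (S₁ : ℕ → ℕ) (K : ℝ), Tendsto β atTop atTop ∧ (∀ k, 0 < mh k) ∧
        0 < K ∧
        (∀ A B : YMSpecies G, ∃ C : ℝ, ∀ k S n : ℕ, S₁ k ≤ S → n ≤ S →
          |latticeConnectedCorr r.ρ (β k) (2 * S + 1) A.F B.F n| ≤ C * Real.exp (-(mh k * n))) ∧
        (∀ k S₀ : ℕ, ∃ A B : YMSpecies G, ∀ C : ℝ, ∃ S n : ℕ, S₀ ≤ S ∧ n ≤ S ∧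
          C * Real.exp (-(K * mh k * n)) <
            |latticeConnectedCorr r.ρ (β k) (2 * S + 1) A.F B.F n|) := by
  sorry

/-- `stub_uvPackage` — **the UV engine at the intrinsic unit** (open; Bałaban/Magnen–Rivasseau–Sénéor class),
reshape 16 (lead c4, 2026-08-17T00:40Z: the (ROT) conjunct is REPLACED by (ROT₃₄₅) — asymptotic invariance under the
SINGLE Pythagorean rotation of the `(x⁰,x¹)`-plane (`cos θ = 3/5`, `sin θ = 4/5`, stated on the axis vectors); full
(ROT) is DERIVED by `stub_rotOfPythagorean` ∘ (`stub_rotNiven`, `stub_rotHyper`) from the landed exact axis symmetry,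
the k-uniform E0′ bound, Niven's theorem and Givens generation; reshape 15: the (UCL) conjunct of reshapes 9–14 is REMOVED — k-uniform spatial clustering
is DERIVED from (CSCL) ∧ (ROT) ∧ (UUVB) ∧ (PVG) and the landed (ARP) by the registered glue stubs `stub_uclOfCscl` ∘
(`stub_asympCS`, `stub_smallRotation`, `stub_bddSlabDensity`); reshape 14, lead c3: the (CL-t) conjunct is REMOVED,
derived by the landed `stub_cltOfCscl`). At some faithful `r`, for every locked critical IR datum (couplings
`β_k → ∞`, rates `m̂_k → 0` with k-UNIFORM pair constants and a sharpness factor), a CANONICALLY normalised, exactly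
centred scheme along a subsequence `β ∘ φ` at the unit `Δ₀ a_k ≤ m̂_{φ k}` on tori `L_k ≥ S₁(φ k)` whose renormalised
curvature functional `LS` has: (VS) exact centring, (CAN) `c_k = a_k⁻⁴`, (UUVB) uniform-threshold E0′ bounds for all
corner-plaquette strings, (ND) a two-point floor on a time-ordered OS pair, (PVG) polynomial volume growth
`a_k⁻¹ ≤ (a_k L_k)^N` eventually (a free choice of the tori; it makes asymptotic TRANSLATION invariance a theorem — route
ParabolicTrajectory's landed `stub_transl`), (ROT) asymptotic proper-rotation invariance on `⁰𝒮` (the E1 burden — an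
output of the UV engine here, no longer a by-name socket), and (CSCL) Cauchy–Schwarz clustering of the canonical
scheme's lattice Schwinger functions at some rate `Δ₁ > 0` (Literature `SpeciesScheme.HasCSClustering`: the
OS-currency statement — WITH `ε`-slack, hence consistent with the thermal wrap-around of the periodic torus, unlike
the idealised slack-free `TorusOSGap` of route ParabolicTrajectory — from which the CONTINUUM gap is read off by
`IsYangMillsFor.hasMassGap_of_hasCSClustering`). Seven conjuncts: (VS)(CAN)(UUVB)(ND)(PVG)(ROT)(CSCL); everything soft
downstream of them is PROVED (reshapes 12–15). [folklore] -/
theorem stub_uvPackage :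
    ∀ (G : Type) [Group G] [TopologicalSpace G] [IsTopologicalGroup G] [CompactSpace G]
      [MeasurableSpace G] [BorelSpace G], IsCompactSimpleLieGroup G → ∃ r : LatticeRep G,
      ∀ (β : ℕ → ℝ) (mh : ℕ → ℝ) (S₁ : ℕ → ℕ) (K : ℝ), Tendsto β atTop atTop → (∀ k, 0 < mh k) → 0 < K →
      (∀ A B : YMSpecies G, ∃ C : ℝ, ∀ k S n : ℕ, S₁ k ≤ S → n ≤ S →
        |latticeConnectedCorr r.ρ (β k) (2 * S + 1) A.F B.F n| ≤ C * Real.exp (-(mh k * n))) →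
      (∀ k S₀ : ℕ, ∃ A B : YMSpecies G, ∀ C : ℝ, ∃ S n : ℕ, S₀ ≤ S ∧ n ≤ S ∧
        C * Real.exp (-(K * mh k * n)) < |latticeConnectedCorr r.ρ (β k) (2 * S + 1) A.F B.F n|) →
      Tendsto mh atTop (𝓝 0) →
      ∃ (sch : SpeciesScheme (YMSpecies G)) (φ : ℕ → ℕ) (Δ₀ : ℝ), StrictMono φ ∧
        (∀ k, sch.β k = β (φ k)) ∧ 0 < Δ₀ ∧ (∀ k, Δ₀ * sch.a k ≤ mh (φ k)) ∧ (∀ k, S₁ (φ k) ≤ sch.L k) ∧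
      ∀ (LS : (k n : ℕ) → SchwartzMap (Fin n → EuclideanSpace ℝ (Fin 4)) ℂ → ℂ),
      (∀ (k n : ℕ) (F : SchwartzMap (Fin n → EuclideanSpace ℝ (Fin 4)) ℂ), LS k n F =
        ∫ U : GaugeConfig 4 (sch.side k) G, ∑ x : Fin n → ↥(box 4 (sch.L k)),
          F (fun i => sch.a k • siteToE ↑(x i)) *
            ∏ i, ((sch.c r.curvature k * sch.a k ^ 4 *
              (r.curvature.F (configShift (-↑(x i)) (torusLift (sch.side k) U)) - sch.m r.curvature k) : ℝ) : ℂ)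
          ∂(wilsonMeasure r.ρ (sch.β k))) →
      (∀ k : ℕ, sch.m r.curvature k =
        ∫ U : GaugeConfig 4 (sch.side k) G, r.curvature.F (torusLift (sch.side k) U) ∂(wilsonMeasure r.ρ (sch.β k))) ∧
      (∀ k : ℕ, sch.c r.curvature k = (sch.a k ^ 4)⁻¹) ∧
      (∃ (s : ℕ) (α β' : ℝ), ∀ᶠ k in atTop, ∀ (p : ℕ) (q : Fin p → {q : Fin 4 × Fin 4 // q.1 < q.2})
        (F : SchwartzMap (Fin p → EuclideanSpace ℝ (Fin 4)) ℂ), IsOffDiagonal F →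
        ‖∫ U : GaugeConfig 4 (sch.side k) G, ∑ x : Fin p → ↥(box 4 (sch.L k)),
            F (fun i => sch.a k • siteToE ↑(x i)) *
              ∏ i, ((plaquetteObs r.ρ 0 (q i).1.1 (q i).1.2 (configShift (-↑(x i)) (torusLift (sch.side k) U)) -
                wilsonTorusMean r.ρ (sch.β k) (sch.L k) (plaquetteObs r.ρ 0 (q i).1.1 (q i).1.2) : ℝ) : ℂ)
            ∂(wilsonMeasure r.ρ (sch.β k))‖ ≤ α * (p.factorial : ℝ) ^ β' * schwartzNorm (p * s) F) ∧
      (∃ (f g : SchwartzMap (Fin 1 → EuclideanSpace ℝ (Fin 4)) ℂ)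
        (H : SchwartzMap (Fin (1 + 1) → EuclideanSpace ℝ (Fin 4)) ℂ),
        IsTimeOrdered f ∧ IsTimeOrdered g ∧ IsAppendTensorOf H (osAdjoint f) g ∧
          ∃ δ : ℝ, 0 < δ ∧ ∀ᶠ k in atTop, δ ≤ ‖LS k (1 + 1) H‖) ∧
      (∃ N : ℕ, 1 ≤ N ∧ ∀ᶠ k in atTop, (sch.a k)⁻¹ ≤ (sch.a k * (sch.L k : ℝ)) ^ N) ∧
      (∀ R : EuclideanSpace ℝ (Fin 4) ≃ₗᵢ[ℝ] EuclideanSpace ℝ (Fin 4),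
        R (EuclideanSpace.single 0 1) =
          (3 / 5 : ℝ) • EuclideanSpace.single 0 1 + (-(4 / 5) : ℝ) • EuclideanSpace.single 1 1 →
        R (EuclideanSpace.single 1 1) =
          (4 / 5 : ℝ) • EuclideanSpace.single 0 1 + (3 / 5 : ℝ) • EuclideanSpace.single 1 1 →
        R (EuclideanSpace.single 2 1) = EuclideanSpace.single 2 1 →
        R (EuclideanSpace.single 3 1) = EuclideanSpace.single 3 1 →
        ∀ (n : ℕ) (F : SchwartzMap (Fin n → EuclideanSpace ℝ (Fin 4)) ℂ), IsOffDiagonal F →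
          Tendsto (fun k : ℕ => LS k n (linActMulti R F) - LS k n F) atTop (𝓝 0)) ∧
      (∃ Δ₁ : ℝ, 0 < Δ₁ ∧ SpeciesScheme.HasCSClustering r
        (Summit.QuantumFields.YangMills.Cruxes.ContinuumLimitOnTrajectory.TwoOrbitSynchronisation.canon r sch) Δ₁) := by
  sorry

/-! ### Reshape 16 (continuation lead c4, 2026-08-17T00:40Z): (ROT) from ONE Pythagorean rotation — three glue stubs

The asymptotic proper-rotation invariance (ROT) is no longer a conjunct of the UV stub: it is DERIVED from asymptotic
invariance under the single rational rotation `ρ_θ` of the `(x⁰, x¹)`-plane with `cos θ = 3/5`, `sin θ = 4/5` (conjunct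
(ROT₃₄₅), stated on the axis vectors), the LANDED exact axis-permutation symmetry of the canonical curvature distributions
(route ParabolicTrajectory's `stub_axisSymmetry`), the k-uniform E0′ bound from (UUVB) (equicontinuity ⇒ the angle set
`{t | P(ρ_t)}` of the asymptotic-invariance predicate `P` is CLOSED), Niven's theorem (a closed additive subgroup of `ℝ`
containing `2π` and `θ` is `ℝ` — `stub_rotNiven`, a `2π`-variant of LangevinControlUV's `rho_all_of_closed`), the
signed permutations as products of axis permutations and quarter/half turns (`stub_rotHyper`), and the landed Givens
generation `PlanarToEuclidean.so4_generation` / `planar_of_rho`. -/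

/-- `stub_rotNiven` — **all angles from one Pythagorean angle** (reshape 16 glue, pure Mathlib + the tree's `planeRot`; LANDED
p133202 in wave 7, `…Theorems.ConvexGribovBodyContinuumLegGivenGapStubRotNiven`, imported by name):
a predicate on the linear isometries of `ℝ⁴` closed under composition and inverses and holding at the identity, whose
angle set along the `(x⁰,x¹)`-rotations is closed and contains some `θ` with `cos θ = 3/5`, holds on every
`(x⁰,x¹)`-rotation: the angle set is a closed additive subgroup of `ℝ` containing `2π` (the rotation by `2π` is the
identity) and `θ`; if it were cyclic, `θ` would be a rational multiple of `π` with `cos θ = 3/5 ∉ {0, ±1/2, ±1}`,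
contradicting Niven's theorem (Mathlib `niven`, `AddSubgroup.dense_or_cyclic`; cf. LangevinControlUV's
`rho_all_of_closed`, which uses `π/2` instead of `2π`). [folklore] -/
theorem rotNiven :
    ∀ (P : (EuclideanSpace ℝ (Fin 4) ≃ₗᵢ[ℝ] EuclideanSpace ℝ (Fin 4)) → Prop),
      (∀ A B, P A → P B → P (A.trans B)) → (∀ A, P A → P A.symm) →
      P (LinearIsometryEquiv.refl ℝ (EuclideanSpace ℝ (Fin 4))) →
      IsClosed {t : ℝ | P (Literature.MathematicalPhysics.QuantumFieldTheory.planeRot (0 : Fin 3) t)} →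
      (∃ θ : ℝ, Real.cos θ = 3 / 5 ∧ P (Literature.MathematicalPhysics.QuantumFieldTheory.planeRot (0 : Fin 3) θ)) →
      ∀ t : ℝ, P (Literature.MathematicalPhysics.QuantumFieldTheory.planeRot (0 : Fin 3) t) :=
  Summit.QuantumFields.YangMills.Theorems.ContinuumLegGivenGap.stub_rotNiven

/-- `stub_rotHyper` — **signed permutations from axis permutations and plane rotations** (reshape 16 glue, elementary; LANDED
p133520 in wave 7, `…Theorems.ConvexGribovBodyContinuumLegGivenGapStubRotHyper`, imported by name):
a predicate on the linear isometries of `ℝ⁴` closed under composition and inverses, holding on every coordinate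
permutation `piLpCongrLeft σ` and on every `(x⁰,x¹)`-rotation, holds on every isometry permuting the axes up to sign:
the single sign flip of `x⁰` is `(piLpCongrLeft (swap 0 1))⁻¹ ∘ ρ_{π/2}` (up to the orientation convention of the
tree's `planeRot`), every single flip is a conjugate of it by a coordinate permutation, a signed permutation is
`signFlip ∘ permIso` (tree `NPointIsotropy.Negative.HyperoctahedralPlane.exists_sp_of_isHyper`). [folklore] -/
theorem rotHyper :
    ∀ (P : (EuclideanSpace ℝ (Fin 4) ≃ₗᵢ[ℝ] EuclideanSpace ℝ (Fin 4)) → Prop),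
      (∀ A B, P A → P B → P (A.trans B)) → (∀ A, P A → P A.symm) →
      (∀ σ : Equiv.Perm (Fin 4), P (LinearIsometryEquiv.piLpCongrLeft 2 ℝ ℝ σ)) →
      (∀ t : ℝ, P (Literature.MathematicalPhysics.QuantumFieldTheory.planeRot (0 : Fin 3) t)) →
      ∀ A : EuclideanSpace ℝ (Fin 4) ≃ₗᵢ[ℝ] EuclideanSpace ℝ (Fin 4),
        (∀ i : Fin 4, ∃ j : Fin 4, A (EuclideanSpace.single i 1) = EuclideanSpace.single j 1 ∨
          A (EuclideanSpace.single i 1) = -EuclideanSpace.single j 1) → P A :=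
  Summit.QuantumFields.YangMills.Theorems.ContinuumLegGivenGap.stub_rotHyper

/-- `stub_rotOfPythagorean` — **(ROT) from (ROT₃₄₅), (UUVB) and the two glue statements** (reshape 16, the assembly;
LANDED by the lead p133709, `…Theorems.ConvexGribovBodyContinuumLegGivenGapStubRotOfPythagorean`, imported by name): for the canonical curvature distributions of a scheme with route ParabolicTrajectory's `UUVB`, asymptotic
invariance under the single Pythagorean rotation of the `(x⁰,x¹)`-plane implies asymptotic invariance under every
determinant-one isometry of `ℝ⁴` on `⁰𝒮`. With `P R := ∀ p F, IsOffDiagonal F → 𝓓_k(R·F) − 𝓓_k(F) → 0`: `P` is a group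
predicate (`isOffDiagonal_linActMulti`); coordinate permutations are EXACT symmetries (landed `stub_axisSymmetry`); the
angle set is closed by the k-uniform E0′ bound (`norm_curvDistribution_le_of_uuvb`, `continuous_linActMulti_rho`);
`stub_rotNiven` gives all `(x⁰,x¹)`-rotations, `stub_rotHyper` the proper signed permutations, and
`PlanarToEuclidean.so4_generation` with `planar_of_rho` (landed) all of `SO(4)`. [folklore] -/
theorem rotOfPythagorean :
    ∀ (G : Type) [Group G] [TopologicalSpace G] [IsTopologicalGroup G] [CompactSpace G]
      [MeasurableSpace G] [BorelSpace G] (r : LatticeRep G) (sch : SpeciesScheme (YMSpecies G)),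
      (∀ (P : (EuclideanSpace ℝ (Fin 4) ≃ₗᵢ[ℝ] EuclideanSpace ℝ (Fin 4)) → Prop),
        (∀ A B, P A → P B → P (A.trans B)) → (∀ A, P A → P A.symm) →
        P (LinearIsometryEquiv.refl ℝ (EuclideanSpace ℝ (Fin 4))) →
        IsClosed {t : ℝ | P (Literature.MathematicalPhysics.QuantumFieldTheory.planeRot (0 : Fin 3) t)} →
        (∃ θ : ℝ, Real.cos θ = 3 / 5 ∧ P (Literature.MathematicalPhysics.QuantumFieldTheory.planeRot (0 : Fin 3) θ)) →
        ∀ t : ℝ, P (Literature.MathematicalPhysics.QuantumFieldTheory.planeRot (0 : Fin 3) t)) →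
      (∀ (P : (EuclideanSpace ℝ (Fin 4) ≃ₗᵢ[ℝ] EuclideanSpace ℝ (Fin 4)) → Prop),
        (∀ A B, P A → P B → P (A.trans B)) → (∀ A, P A → P A.symm) →
        (∀ σ : Equiv.Perm (Fin 4), P (LinearIsometryEquiv.piLpCongrLeft 2 ℝ ℝ σ)) →
        (∀ t : ℝ, P (Literature.MathematicalPhysics.QuantumFieldTheory.planeRot (0 : Fin 3) t)) →
        ∀ A : EuclideanSpace ℝ (Fin 4) ≃ₗᵢ[ℝ] EuclideanSpace ℝ (Fin 4),
          (∀ i : Fin 4, ∃ j : Fin 4, A (EuclideanSpace.single i 1) = EuclideanSpace.single j 1 ∨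
            A (EuclideanSpace.single i 1) = -EuclideanSpace.single j 1) → P A) →
      Summit.QuantumFields.YangMills.Cruxes.ContinuumLimitOnTrajectory.TwoOrbitSynchronisation.UUVB r sch →
      (∀ R : EuclideanSpace ℝ (Fin 4) ≃ₗᵢ[ℝ] EuclideanSpace ℝ (Fin 4),
        R (EuclideanSpace.single 0 1) =
          (3 / 5 : ℝ) • EuclideanSpace.single 0 1 + (-(4 / 5) : ℝ) • EuclideanSpace.single 1 1 →
        R (EuclideanSpace.single 1 1) =
          (4 / 5 : ℝ) • EuclideanSpace.single 0 1 + (3 / 5 : ℝ) • EuclideanSpace.single 1 1 →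
        R (EuclideanSpace.single 2 1) = EuclideanSpace.single 2 1 →
        R (EuclideanSpace.single 3 1) = EuclideanSpace.single 3 1 →
        ∀ (p : ℕ) (F : SchwartzMap (Fin p → EuclideanSpace ℝ (Fin 4)) ℂ), IsOffDiagonal F →
          Tendsto (fun k : ℕ =>
            Summit.QuantumFields.YangMills.Cruxes.ContinuumLimitOnTrajectory.TwoOrbitSynchronisation.curvDistribution
                r sch k p (linActMulti R F) -
              Summit.QuantumFields.YangMills.Cruxes.ContinuumLimitOnTrajectory.TwoOrbitSynchronisation.curvDistribution
                r sch k p F) atTop (𝓝 0)) →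
      ∀ (p : ℕ) (F : SchwartzMap (Fin p → EuclideanSpace ℝ (Fin 4)) ℂ), IsOffDiagonal F →
        ∀ R : EuclideanSpace ℝ (Fin 4) ≃ₗᵢ[ℝ] EuclideanSpace ℝ (Fin 4),
          LinearMap.det (R.toLinearEquiv : EuclideanSpace ℝ (Fin 4) →ₗ[ℝ] EuclideanSpace ℝ (Fin 4)) = 1 →
            Tendsto (fun k : ℕ =>
              Summit.QuantumFields.YangMills.Cruxes.ContinuumLimitOnTrajectory.TwoOrbitSynchronisation.curvDistribution
                  r sch k p (linActMulti R F) -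
                Summit.QuantumFields.YangMills.Cruxes.ContinuumLimitOnTrajectory.TwoOrbitSynchronisation.curvDistribution
                  r sch k p F) atTop (𝓝 0) :=
  Summit.QuantumFields.YangMills.Theorems.ContinuumLegGivenGap.stub_rotOfPythagorean

/-! ### Reshape 15 (continuation lead c4, 2026-08-16T23:30Z): (UCL) is DERIVED — four glue stubs

The k-uniform rate-free SPATIAL clustering (UCL) (route ParabolicTrajectory's E4 input `UCL r sch`) is no longer a
conjunct of the UV stub. It follows from conjuncts the stub already carries — (CSCL) time-direction Cauchy–Schwarz
clustering, (ROT) asymptotic proper-rotation invariance, (UUVB) k-uniform E0′ bounds, (PVG) (hence the landed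
translation half of E1) — and the landed (ARP), by TILTING the spatial direction into Euclidean time: for test data
with bounded time and bounded `xⁱ`-coordinate (`i` a coordinate where `a i ≠ 0`), a proper rotation `R` of the
`(x⁰, xⁱ)`-plane by a small angle keeps slab-ordered real product data slab-ordered (both `R` and `θRθ = R⁻¹`), and
`R · (ΘP* ⊗ T_{ta} Q) = Θ(R⁻¹·P)* ⊗ T_{s e₀} (T_b (R·Q))` with `s = t (Ra)⁰ > 0` linear in `t` and `b` spatial; (CSCL) on
the spans (landed `clustersCS_span`) bounds the truncated pairing by `e^{−Δ₁ s} · ‖·‖ · ‖·‖ + ε` with Cauchy–Schwarz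
norms that are `t`-UNIFORM (asymptotic translation/rotation invariance moves `T_b`, `R` off the norms); general
time-ordered pairs by the density of `xⁱ`-bounded slab-ordered real product tensors in the ordered wedge and a
`t`-uniform asymptotic Cauchy–Schwarz inequality (from (ARP) + (UVB): finite nets on a coefficient disc, the
`Im`-clause of (ARP) for asymptotic hermiticity). Stubs: `stub_asympCS` (abstract asymptotic Cauchy–Schwarz for
asymptotically positive `2 × 2` sequences), `stub_smallRotation` (a determinant-one isometry of `ℝ⁴` tilting `e_{i+1}`
into time by a prescribed small amount), `stub_bddSlabDensity` (ordered-wedge density with `xⁱ`-bounded factors),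
`stub_uclOfCscl` (the assembly, taking the three previous statements as hypotheses). -/

/-- `stub_asympCS` — **asymptotic Cauchy–Schwarz for an asymptotically positive `2 × 2` sequence** (reshape 15 glue,
pure analysis; LANDED p130870 in wave 6, `…Theorems.ConvexGribovBodyContinuumLegGivenGapStubAsympCS`, imported by name): if the sequences `A, B, B', D : ℕ → ℂ` are eventually bounded and for every coefficient `μ` the
quadratic expression `A + μB + μ̄B' + |μ|²D` is eventually almost real-non-negative (the shape (ARP) delivers for the
scaled OS family `(F, μG')`, with `A = 𝓓(ΘF*⊗F)`, `B = 𝓓(ΘF*⊗G')`, `B' = 𝓓(ΘG'*⊗F)`, `D = 𝓓(ΘG'*⊗G')`), then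
eventually `‖B‖ ≤ √‖A‖ √‖D‖ + η`. Route: `μ = ±R` real gives `|Im D|, (Re D)₋` small; unit `μ = ω` gives asymptotic
hermiticity `‖B − B̄'‖ ≤ 4ε`; a finite net of the disc `|μ| ≤ S(ε)` (the quadratic is Lipschitz in `μ` with an eventual
constant from the bounds) makes the inequality uniform in `μ`, and `μ = −√((Re A + 2ε)/(Re D + 2ε)) · B̄/‖B‖` concludes
(AM–GM). [folklore] -/
theorem asympCS :
    ∀ (A B B' D : ℕ → ℂ),
      (∃ C : ℝ, ∀ᶠ k in atTop, ‖A k‖ ≤ C ∧ ‖B k‖ ≤ C ∧ ‖B' k‖ ≤ C ∧ ‖D k‖ ≤ C) →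
      (∀ (μ : ℂ) (ε : ℝ), 0 < ε → ∀ᶠ k in atTop,
        -ε ≤ (A k + μ * B k + (starRingEnd ℂ) μ * B' k + (starRingEnd ℂ) μ * μ * D k).re ∧
          |(A k + μ * B k + (starRingEnd ℂ) μ * B' k + (starRingEnd ℂ) μ * μ * D k).im| ≤ ε) →
      ∀ η : ℝ, 0 < η → ∀ᶠ k in atTop, ‖B k‖ ≤ Real.sqrt ‖A k‖ * Real.sqrt ‖D k‖ + η :=
  Summit.QuantumFields.YangMills.Theorems.ContinuumLegGivenGap.stub_asympCS

/-- `stub_smallRotation` — **a determinant-one isometry of `ℝ⁴` tilting the spatial axis `e_{i+1}` into Euclidean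
time by a prescribed small amount** (reshape 15 glue, elementary; LANDED p131039 in wave 6,
`…Theorems.ConvexGribovBodyContinuumLegGivenGapStubSmallRotation`, imported by name): for `σ ≠ 0`, `ρ > 0`, `g > 0` there is a linear
isometry `R` of `ℝ⁴` of determinant one and reals `c ∈ (0, 1]`, `s` of the sign of `σ`, with `(Rx)⁰ = c x⁰ + s x^{i+1}`,
`(R⁻¹x)⁰ = c x⁰ − s x^{i+1}` and `(1 − c)ρ ≤ g`, `|s|ρ ≤ g` — so that points with `|x⁰|, |x^{i+1}| ≤ ρ` move in time by
at most `2g` under `R^{±1}`. Witness: the tree's `Literature.MathematicalPhysics.QuantumFieldTheory.planeRot i φ` with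
`0 < |φ| ≤ min 1 (g/ρ)` of the sign of `σ` (`det = 1` as in `…StubUpgradeGivens.det_rho`: `planeRot i φ` is the square
of `planeRot i (φ/2)` and an isometry has determinant `±1`). [folklore] -/
theorem smallRotation :
    ∀ (i : Fin 3) (σ ρ g : ℝ), σ ≠ 0 → 0 < ρ → 0 < g →
      ∃ (R : EuclideanSpace ℝ (Fin 4) ≃ₗᵢ[ℝ] EuclideanSpace ℝ (Fin 4)) (c s : ℝ),
        LinearMap.det (R.toLinearEquiv : EuclideanSpace ℝ (Fin 4) →ₗ[ℝ] EuclideanSpace ℝ (Fin 4)) = 1 ∧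
        (∀ x : EuclideanSpace ℝ (Fin 4), R x 0 = c * x 0 + s * x i.succ) ∧
        (∀ x : EuclideanSpace ℝ (Fin 4), R.symm x 0 = c * x 0 - s * x i.succ) ∧
        0 < σ * s ∧ 0 < c ∧ c ≤ 1 ∧ (1 - c) * ρ ≤ g ∧ |s| * ρ ≤ g :=
  Summit.QuantumFields.YangMills.Theorems.ContinuumLegGivenGap.stub_smallRotation

/-- `stub_bddSlabDensity` — **ordered-wedge density with `xⁱ`-bounded factors** (reshape 15 glue; LANDED p131325 in
wave 6, `…Theorems.ConvexGribovBodyContinuumLegGivenGapStubBddSlabDensity`, imported by name): every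
time-ordered `F` lies in the closure of the `ℂ`-span of the real product tensors whose factor data are slab-ordered
(`IsSlabOrdered`) AND supported in a bounded range of the coordinate `i`. Route: the tree's ordered-wedge density
`IsTimeOrdered.mem_closure_span_slabOrderedProducts` puts `F` in the closure of the span of ALL slab-ordered real
product tensors; each such `P = ⊗ₗ pₗ` is the limit of its coordinate cut-offs `cutLE i ρ (cutGE i (−ρ) P)` as
`ρ → ∞` (`SchwartzHalfSpaceCutoffC.tendsto_cutLE_atTop/tendsto_cutGE_atBot`, uniform seminorm bounds of `cutLE`),
and the cut-off is again a real product tensor, of the factors multiplied by the one-point smooth steps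
`σ(ρ + 1 − xⁱ) σ(xⁱ + ρ + 1)` (`cutLE_apply`, the weights are products over the points), whose supports lie in
`supp pₗ ∩ {|xⁱ| ≤ ρ + 1}` — still slab-ordered. [folklore] -/
theorem bddSlabDensity :
    ∀ (n : ℕ) (i : Fin 4) (F : SchwartzMap (Fin n → EuclideanSpace ℝ (Fin 4)) ℂ), IsTimeOrdered F →
      F ∈ closure ((Submodule.span ℂ {P : SchwartzMap (Fin n → EuclideanSpace ℝ (Fin 4)) ℂ |
          ∃ (p : Fin n → SchwartzMap (EuclideanSpace ℝ (Fin 4)) ℝ) (ρ : ℝ),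
            IsTensorOf P (fun l => ofRealTest (p l)) ∧ IsSlabOrdered p ∧
              ∀ l, tsupport (p l : EuclideanSpace ℝ (Fin 4) → ℝ) ⊆ {x | |x i| ≤ ρ}} :
        Submodule ℂ (SchwartzMap (Fin n → EuclideanSpace ℝ (Fin 4)) ℂ)) :
        Set (SchwartzMap (Fin n → EuclideanSpace ℝ (Fin 4)) ℂ)) :=
  Summit.QuantumFields.YangMills.Theorems.ContinuumLegGivenGap.stub_bddSlabDensity

/-- `stub_uclOfCscl` — **(UCL) from (CSCL), (ROT), (UUVB), (PVG) and the three glue statements** (reshape 15, the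
assembly; LANDED by the lead: `…Theorems.ConvexGribovBodyContinuumLegGivenGapStubUclOfCscl` with parts `…StubUclOfCsclA`
p131644, `…StubUclOfCsclTilt` p132162, `…StubUclOfCsclB` p132357; imported by name): for a scheme at weak coupling (`β_k → ∞`, which gives the landed (ARP) via odd-torus
reflection positivity) with route ParabolicTrajectory's `UUVB`, polynomial volume growth (hence the landed translation
half of E1), asymptotic proper-rotation invariance of the canonical curvature distributions and Cauchy–Schwarz
clustering of the canonical scheme at some rate `Δ₁ > 0`, the k-uniform rate-free spatial clustering `UCL r sch` holds.
The first three hypotheses are the statements of `stub_asympCS`, `stub_smallRotation`, `stub_bddSlabDensity`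
verbatim. See the reshape-15 docblock for the tilting argument. [folklore] -/
theorem uclOfCscl :
    ∀ (G : Type) [Group G] [TopologicalSpace G] [IsTopologicalGroup G] [CompactSpace G]
      [MeasurableSpace G] [BorelSpace G] (r : LatticeRep G) (sch : SpeciesScheme (YMSpecies G)),
      (∀ (A B B' D : ℕ → ℂ),
        (∃ C : ℝ, ∀ᶠ k in atTop, ‖A k‖ ≤ C ∧ ‖B k‖ ≤ C ∧ ‖B' k‖ ≤ C ∧ ‖D k‖ ≤ C) →
        (∀ (μ : ℂ) (ε : ℝ), 0 < ε → ∀ᶠ k in atTop,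
          -ε ≤ (A k + μ * B k + (starRingEnd ℂ) μ * B' k + (starRingEnd ℂ) μ * μ * D k).re ∧
            |(A k + μ * B k + (starRingEnd ℂ) μ * B' k + (starRingEnd ℂ) μ * μ * D k).im| ≤ ε) →
        ∀ η : ℝ, 0 < η → ∀ᶠ k in atTop, ‖B k‖ ≤ Real.sqrt ‖A k‖ * Real.sqrt ‖D k‖ + η) →
      (∀ (i : Fin 3) (σ ρ g : ℝ), σ ≠ 0 → 0 < ρ → 0 < g →
        ∃ (R : EuclideanSpace ℝ (Fin 4) ≃ₗᵢ[ℝ] EuclideanSpace ℝ (Fin 4)) (c s : ℝ),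
          LinearMap.det (R.toLinearEquiv : EuclideanSpace ℝ (Fin 4) →ₗ[ℝ] EuclideanSpace ℝ (Fin 4)) = 1 ∧
          (∀ x : EuclideanSpace ℝ (Fin 4), R x 0 = c * x 0 + s * x i.succ) ∧
          (∀ x : EuclideanSpace ℝ (Fin 4), R.symm x 0 = c * x 0 - s * x i.succ) ∧
          0 < σ * s ∧ 0 < c ∧ c ≤ 1 ∧ (1 - c) * ρ ≤ g ∧ |s| * ρ ≤ g) →
      (∀ (n : ℕ) (i : Fin 4) (F : SchwartzMap (Fin n → EuclideanSpace ℝ (Fin 4)) ℂ), IsTimeOrdered F →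
        F ∈ closure ((Submodule.span ℂ {P : SchwartzMap (Fin n → EuclideanSpace ℝ (Fin 4)) ℂ |
            ∃ (p : Fin n → SchwartzMap (EuclideanSpace ℝ (Fin 4)) ℝ) (ρ : ℝ),
              IsTensorOf P (fun l => ofRealTest (p l)) ∧ IsSlabOrdered p ∧
                ∀ l, tsupport (p l : EuclideanSpace ℝ (Fin 4) → ℝ) ⊆ {x | |x i| ≤ ρ}} :
          Submodule ℂ (SchwartzMap (Fin n → EuclideanSpace ℝ (Fin 4)) ℂ)) :
          Set (SchwartzMap (Fin n → EuclideanSpace ℝ (Fin 4)) ℂ))) →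
      Tendsto sch.β atTop atTop →
      Summit.QuantumFields.YangMills.Cruxes.ContinuumLimitOnTrajectory.TwoOrbitSynchronisation.UUVB r sch →
      Summit.QuantumFields.YangMills.Cruxes.ContinuumLimitOnTrajectory.TwoOrbitSynchronisation.PolyVolumeGrowth sch →
      (∀ (p : ℕ) (F : SchwartzMap (Fin p → EuclideanSpace ℝ (Fin 4)) ℂ), IsOffDiagonal F →
        ∀ R : EuclideanSpace ℝ (Fin 4) ≃ₗᵢ[ℝ] EuclideanSpace ℝ (Fin 4),
          LinearMap.det (R.toLinearEquiv : EuclideanSpace ℝ (Fin 4) →ₗ[ℝ] EuclideanSpace ℝ (Fin 4)) = 1 →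
            Tendsto (fun k : ℕ =>
              Summit.QuantumFields.YangMills.Cruxes.ContinuumLimitOnTrajectory.TwoOrbitSynchronisation.curvDistribution
                  r sch k p (linActMulti R F) -
                Summit.QuantumFields.YangMills.Cruxes.ContinuumLimitOnTrajectory.TwoOrbitSynchronisation.curvDistribution
                  r sch k p F) atTop (𝓝 0)) →
      (∃ Δ₁ : ℝ, 0 < Δ₁ ∧ SpeciesScheme.HasCSClustering r
        (Summit.QuantumFields.YangMills.Cruxes.ContinuumLimitOnTrajectory.TwoOrbitSynchronisation.canon r sch) Δ₁) →
      Summit.QuantumFields.YangMills.Cruxes.ContinuumLimitOnTrajectory.TwoOrbitSynchronisation.UCL r sch :=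
  Summit.QuantumFields.YangMills.Theorems.ContinuumLegGivenGap.stub_uclOfCscl

/-- **(CL-t) is the per-pair shadow of (CSCL)** — the registered `stub_cltOfCscl` of reshape 14, LANDED p129089 (wave 5,
`…Theorems.ConvexGribovBodyContinuumLegGivenGapStubCltOfCscl`, 388 lines) and imported by name: for ANY scheme whose renormalised curvature functional `LS` (given by its defining equation) is
canonically normalised (CAN) and exactly centred (VS), has the uniform-threshold plaquette-string bounds (UUVB) and
polynomial volume growth (PVG), Cauchy–Schwarz clustering of the canonical scheme's lattice Schwinger functions at rate
`Δ₁` (CSCL, Literature `SpeciesScheme.HasCSClustering` = `ClustersCS` on finite families of slab-ordered real factor data,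
with `ε`-slack, eventually in `k`) implies time-axis exponential clustering at the same rate with per-pair constants for
ALL pairs of time-ordered complex test functions (CL-t). Proof route: (i) with (CAN) ∧ (VS), `LS = curvDistribution`
(landed `lsk_eq_curvDistribution`) and on real product tensors `curvDistribution = curvNPoint =` the canonical
`latticeSchwinger` (route ParabolicTrajectory's landed `osLegsA_curvDistribution_tensor`, `latticeSchwinger_canon_curv`);
(ii) a UNIFORM-threshold E0′ bound for `LS` from (UUVB) (`Transl.norm_curvDistribution_le_of_uuvb`); (iii) for `F`, `G'`
in the `ℂ`-span of `slabOrderedProducts`, expand sesquilinearly and apply (CSCL) with `ε := e^{-Δ₁ t}`, bounding the two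
square roots by (ii); (iv) general time-ordered `F`, `G'` by the ordered-wedge density
`IsTimeOrdered.mem_closure_span_slabOrderedProducts` and the k-UNIFORM continuity (ii); (v) degenerate arities `n = 0` or
`m = 0`: the truncated quantity is `LS`-translation non-invariance, which tends to `0` by the landed translation half of E1
(`euc_of_pvg`: PT's `stub_transl` from (PVG) ∧ (UUVB)). [folklore] -/
theorem cltOfCscl :
    ∀ (G : Type) [Group G] [TopologicalSpace G] [IsTopologicalGroup G] [CompactSpace G]
      [MeasurableSpace G] [BorelSpace G] (r : LatticeRep G) (sch : SpeciesScheme (YMSpecies G))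
      (LS : (k n : ℕ) → SchwartzMap (Fin n → EuclideanSpace ℝ (Fin 4)) ℂ → ℂ),
      (∀ (k n : ℕ) (F : SchwartzMap (Fin n → EuclideanSpace ℝ (Fin 4)) ℂ), LS k n F =
        ∫ U : GaugeConfig 4 (sch.side k) G, ∑ x : Fin n → ↥(box 4 (sch.L k)),
          F (fun i => sch.a k • siteToE ↑(x i)) *
            ∏ i, ((sch.c r.curvature k * sch.a k ^ 4 *
              (r.curvature.F (configShift (-↑(x i)) (torusLift (sch.side k) U)) - sch.m r.curvature k) : ℝ) : ℂ)
          ∂(wilsonMeasure r.ρ (sch.β k))) →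
      (∀ k : ℕ, sch.c r.curvature k = (sch.a k ^ 4)⁻¹) →
      (∀ k : ℕ, sch.m r.curvature k =
        ∫ U : GaugeConfig 4 (sch.side k) G, r.curvature.F (torusLift (sch.side k) U) ∂(wilsonMeasure r.ρ (sch.β k))) →
      (∃ (s : ℕ) (α β' : ℝ), ∀ᶠ k in atTop, ∀ (p : ℕ) (q : Fin p → {q : Fin 4 × Fin 4 // q.1 < q.2})
        (F : SchwartzMap (Fin p → EuclideanSpace ℝ (Fin 4)) ℂ), IsOffDiagonal F →
        ‖∫ U : GaugeConfig 4 (sch.side k) G, ∑ x : Fin p → ↥(box 4 (sch.L k)),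
            F (fun i => sch.a k • siteToE ↑(x i)) *
              ∏ i, ((plaquetteObs r.ρ 0 (q i).1.1 (q i).1.2 (configShift (-↑(x i)) (torusLift (sch.side k) U)) -
                wilsonTorusMean r.ρ (sch.β k) (sch.L k) (plaquetteObs r.ρ 0 (q i).1.1 (q i).1.2) : ℝ) : ℂ)
            ∂(wilsonMeasure r.ρ (sch.β k))‖ ≤ α * (p.factorial : ℝ) ^ β' * schwartzNorm (p * s) F) →
      (∃ N : ℕ, 1 ≤ N ∧ ∀ᶠ k in atTop, (sch.a k)⁻¹ ≤ (sch.a k * (sch.L k : ℝ)) ^ N) →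
      (∃ Δ₁ : ℝ, 0 < Δ₁ ∧ SpeciesScheme.HasCSClustering r
        (Summit.QuantumFields.YangMills.Cruxes.ContinuumLimitOnTrajectory.TwoOrbitSynchronisation.canon r sch) Δ₁) →
      ∃ Δ : ℝ, 0 < Δ ∧ ∀ (n m : ℕ) (F : SchwartzMap (Fin n → EuclideanSpace ℝ (Fin 4)) ℂ)
        (G' : SchwartzMap (Fin m → EuclideanSpace ℝ (Fin 4)) ℂ), IsTimeOrdered F → IsTimeOrdered G' →
        ∃ C : ℝ, ∀ t : ℝ, 0 ≤ t → ∀ᶠ k in atTop,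
          ∀ H : SchwartzMap (Fin (n + m) → EuclideanSpace ℝ (Fin 4)) ℂ,
            IsAppendTensorOf H (osAdjoint F) (translateMulti (EuclideanSpace.single 0 t) G') →
              ‖LS k (n + m) H - LS k n (osAdjoint F) * LS k m G'‖ ≤ C * Real.exp (-Δ * t) :=
  Summit.QuantumFields.YangMills.Theorems.ContinuumLegGivenGap.stub_cltOfCscl

/-- **Compactness extraction** (the registered `stub_extract`, LANDED p126320 — route LangevinControlUV's
`exists_subseq_clm_limit` (Cantor diagonal + ε/3 + separability of `⁰𝒮`) applied to route ParabolicTrajectory's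
`curvCLM`, with the uniform-threshold bound `Transl.norm_curvDistribution_le_of_uuvb`): for a
scheme with (UUVB) (the clause reads only `a, β, L`), inside ANY infinitely-often visited set of steps `S` there is a strictly increasing
reindexing `ψ` along which every canonical curvature `p`-point function converges on every off-diagonal real product
tensor — `ConvProducts` for the sub-scheme (Literature `subScheme`; `curvNPoint (subScheme sch ψ) k = curvNPoint sch (ψ k)`
definitionally). Choosing `S` = the (NG) frequently-set makes the skewness floor EVENTUAL along `ψ`. [folklore] -/
theorem extract :
    ∀ (G : Type) [Group G] [TopologicalSpace G] [IsTopologicalGroup G] [CompactSpace G]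
      [MeasurableSpace G] [BorelSpace G] (r : LatticeRep G) (sch : SpeciesScheme (YMSpecies G)),
      (∃ (s : ℕ) (α β' : ℝ), ∀ᶠ k in atTop, ∀ (p : ℕ) (q : Fin p → {q : Fin 4 × Fin 4 // q.1 < q.2})
        (F : SchwartzMap (Fin p → EuclideanSpace ℝ (Fin 4)) ℂ), IsOffDiagonal F →
        ‖∫ U : GaugeConfig 4 (sch.side k) G, ∑ x : Fin p → ↥(box 4 (sch.L k)),
            F (fun i => sch.a k • siteToE ↑(x i)) *
              ∏ i, ((plaquetteObs r.ρ 0 (q i).1.1 (q i).1.2 (configShift (-↑(x i)) (torusLift (sch.side k) U)) -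
                wilsonTorusMean r.ρ (sch.β k) (sch.L k) (plaquetteObs r.ρ 0 (q i).1.1 (q i).1.2) : ℝ) : ℂ)
            ∂(wilsonMeasure r.ρ (sch.β k))‖ ≤ α * (p.factorial : ℝ) ^ β' * schwartzNorm (p * s) F) →
      ∀ S : Set ℕ, (∃ᶠ k in atTop, k ∈ S) →
        ∃ (ψ : ℕ → ℕ) (hψ : StrictMono ψ), (∀ j, ψ j ∈ S) ∧
          Summit.QuantumFields.YangMills.Cruxes.ContinuumLimitOnTrajectory.TwoOrbitSynchronisation.ConvProducts r
            (Literature.Barriers.QuantumFields.subScheme sch ψ hψ) :=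
  Summit.QuantumFields.YangMills.Theorems.ContinuumLegGivenGap.stub_extract

/-- `stub_skewWindow` — **card K1 ∧ K2: the NLO skewness window of the Clay species** (open; UV engine
at second order + the one-loop certificate `s₃ ≠ 0`), reshape 9 (as reshape 8 — weak coupling, subsequential
conclusion, `LS` by its defining equation — with the clustering hypothesis now the satisfiable time-axis
(CL-t)): for every weak-coupling scheme pinned by (VS), (UVB), (ND), (CL-t), some sequence of off-diagonal
triangle tensors with positive weights has normalised lattice third cumulants converging, first in `k` along
`φ` then in `j`, to a non-zero `s₃` — the universal order-`g²` coefficient (the tree term vanishes by duality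
selection: landed `trace_twoForm_triple_eq_zero`; scalar vs pseudoscalar gluonic correlators differ at NLO in
print, 73/4 vs 97/4). [folklore] -/
theorem stub_skewWindow :
    ∀ (G : Type) [Group G] [TopologicalSpace G] [IsTopologicalGroup G] [CompactSpace G]
      [MeasurableSpace G] [BorelSpace G], IsCompactSimpleLieGroup G →
      ∀ (r : LatticeRep G) (sch : SpeciesScheme (YMSpecies G))
        (LS : (k n : ℕ) → SchwartzMap (Fin n → EuclideanSpace ℝ (Fin 4)) ℂ → ℂ),
      (∀ (k n : ℕ) (F : SchwartzMap (Fin n → EuclideanSpace ℝ (Fin 4)) ℂ), LS k n F =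
        ∫ U : GaugeConfig 4 (sch.side k) G, ∑ x : Fin n → ↥(box 4 (sch.L k)),
          F (fun i => sch.a k • siteToE ↑(x i)) *
            ∏ i, ((sch.c r.curvature k * sch.a k ^ 4 *
              (r.curvature.F (configShift (-↑(x i)) (torusLift (sch.side k) U)) - sch.m r.curvature k) : ℝ) : ℂ)
          ∂(wilsonMeasure r.ρ (sch.β k))) →
      Tendsto sch.β atTop atTop →
      (∀ k : ℕ, sch.m r.curvature k =
        ∫ U : GaugeConfig 4 (sch.side k) G, r.curvature.F (torusLift (sch.side k) U) ∂(wilsonMeasure r.ρ (sch.β k))) →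
      (∃ (s : ℕ) (α β' : ℝ), ∀ (n : ℕ) (F : SchwartzMap (Fin n → EuclideanSpace ℝ (Fin 4)) ℂ),
        IsOffDiagonal F → ∀ᶠ k in atTop, ‖LS k n F‖ ≤ α * (n.factorial : ℝ) ^ β' * schwartzNorm (n * s) F) →
      (∃ (f g : SchwartzMap (Fin 1 → EuclideanSpace ℝ (Fin 4)) ℂ)
        (H : SchwartzMap (Fin (1 + 1) → EuclideanSpace ℝ (Fin 4)) ℂ),
        IsTimeOrdered f ∧ IsTimeOrdered g ∧ IsAppendTensorOf H (osAdjoint f) g ∧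
          ∃ δ : ℝ, 0 < δ ∧ ∀ᶠ k in atTop, δ ≤ ‖LS k (1 + 1) H‖) →
      (∃ Δ : ℝ, 0 < Δ ∧ ∀ (n m : ℕ) (F : SchwartzMap (Fin n → EuclideanSpace ℝ (Fin 4)) ℂ)
        (G' : SchwartzMap (Fin m → EuclideanSpace ℝ (Fin 4)) ℂ), IsTimeOrdered F → IsTimeOrdered G' →
        ∃ C : ℝ, ∀ t : ℝ, 0 ≤ t → ∀ᶠ k in atTop,
          ∀ H : SchwartzMap (Fin (n + m) → EuclideanSpace ℝ (Fin 4)) ℂ,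
            IsAppendTensorOf H (osAdjoint F) (translateMulti (EuclideanSpace.single 0 t) G') →
              ‖LS k (n + m) H - LS k n (osAdjoint F) * LS k m G'‖ ≤ C * Real.exp (-Δ * t)) →
      ∃ (s₃ : ℂ) (φ : ℕ → ℕ) (f g h : ℕ → SchwartzMap (EuclideanSpace ℝ (Fin 4)) ℂ)
        (F₃ : ℕ → SchwartzMap (Fin 3 → EuclideanSpace ℝ (Fin 4)) ℂ) (w : ℕ → ℝ),
        s₃ ≠ 0 ∧ StrictMono φ ∧ (∀ j, 0 < w j) ∧
          (∀ j, IsTensorOf (F₃ j) ![f j, g j, h j] ∧ IsOffDiagonal (F₃ j)) ∧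
          ∀ ε : ℝ, 0 < ε → ∀ᶠ j in atTop, ∀ᶠ k in atTop, ‖LS (φ k) 3 (F₃ j) / (w j : ℂ) - s₃‖ ≤ ε := by
  sorry

/-! ## §3 Composition (sorries only in the open `stub_*`; landed stubs by name; every glue lemma below is PROVED) -/

/-! ### §3.1 The UV package at the chosen representation -/

/-- Abbreviation-level repackaging of `stub_uvPackage`'s output at the representation it chooses. [folklore] -/
theorem uvPackage_exists (hG : IsCompactSimpleLieGroup G) :
    ∃ r : LatticeRep G, ∀ {β : ℕ → ℝ} {mh : ℕ → ℝ} {S₁ : ℕ → ℕ} {K : ℝ},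
      LockedAlong r β mh S₁ K → Tendsto mh atTop (𝓝 0) →
        ∃ (sch : SpeciesScheme (YMSpecies G)) (φ : ℕ → ℕ) (Δ₀ : ℝ), StrictMono φ ∧
          (∀ k, sch.β k = β (φ k)) ∧ 0 < Δ₀ ∧ (∀ k, Δ₀ * sch.a k ≤ mh (φ k)) ∧ (∀ k, S₁ (φ k) ≤ sch.L k) ∧
            VS r sch ∧ CAN r sch ∧ UUVB r sch ∧ ND r sch ∧ CLt r sch ∧ UCL r sch ∧ PVG sch ∧ ROT r sch ∧
              CSCL r sch := by
  obtain ⟨r, hr⟩ := stub_uvPackage G hG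
  refine ⟨r, @fun β mh S₁ K hL hcrit => ?_⟩
  obtain ⟨sch, φ, Δ₀, hφ, hβ, hΔ₀, ha, hLk, hprops⟩ :=
    hr _ _ _ _ hL.1 hL.2.1 hL.2.2.1 hL.2.2.2.1 hL.2.2.2.2 hcrit
  obtain ⟨hVS, hCAN, hUUVB, hND, hPVG, hROT345, hCS⟩ := hprops (LSk r sch) fun _ _ _ => rfl
  have hlsk := lsk_eq_curvDistribution r sch (LSk r sch) (fun _ _ _ => rfl) hCAN hVS
  -- reshape 16: (ROT) is derived from (ROT₃₄₅) ∧ (UUVB) by `stub_rotOfPythagorean` ∘ (`stub_rotNiven`, `stub_rotHyper`)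
  have hROT : ROT r sch := by
    intro n F hF R hR
    have h := rotOfPythagorean G r sch rotNiven rotHyper (uuvb_of_unfolded r sch hUUVB)
      (fun R' h0 h1 h2 h3 p F' hF' => by simpa only [hlsk] using hROT345 R' h0 h1 h2 h3 p F' hF') n F hF R hR
    simpa only [hlsk] using h
  -- reshape 14: (CL-t) is derived from (CAN) ∧ (VS) ∧ (UUVB) ∧ (PVG) ∧ (CSCL) by the glue stub `stub_cltOfCscl`
  have hCLt : CLt r sch := cltOfCscl G r sch (LSk r sch) (fun _ _ _ => rfl) hCAN hVS hUUVB hPVG hCS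
  -- reshape 15: (UCL) (route ParabolicTrajectory's `UCL r sch`, on `curvDistribution`) is derived from
  -- (CSCL) ∧ (ROT) ∧ (UUVB) ∧ (PVG) ∧ (AF) by `stub_uclOfCscl` ∘ (`stub_asympCS`, `stub_smallRotation`,
  -- `stub_bddSlabDensity`); the weak-coupling clause `β_k → ∞` rides along `φ`
  have hAF : Tendsto sch.β atTop atTop := by
    rw [show sch.β = fun k => β (φ k) from funext hβ]
    exact hL.1.comp hφ.tendsto_atTop
  have hROT' : ∀ (p : ℕ) (F : 𝓢((Fin p → EuclideanSpace ℝ (Fin 4)), ℂ)), IsOffDiagonal F →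
      ∀ R : EuclideanSpace ℝ (Fin 4) ≃ₗᵢ[ℝ] EuclideanSpace ℝ (Fin 4),
        LinearMap.det (R.toLinearEquiv : EuclideanSpace ℝ (Fin 4) →ₗ[ℝ] EuclideanSpace ℝ (Fin 4)) = 1 →
          Tendsto (fun k : ℕ => curvDistribution r sch k p (linActMulti R F) - curvDistribution r sch k p F)
            atTop (𝓝 0) := by
    intro p F hF R hR
    simpa only [hlsk] using hROT p F hF R hR
  have hUCL : UCL r sch :=
    uclOfCscl G r sch asympCS smallRotation bddSlabDensity hAF (uuvb_of_unfolded r sch hUUVB)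
      hPVG hROT' hCS
  exact ⟨sch, φ, Δ₀, hφ, hβ, hΔ₀, ha, hLk, hVS, hCAN, hUUVB, hND, hCLt, hUCL, hPVG, hROT, hCS⟩

/-! ### §3.2 The IR lock, criticality, the lattice gap -/

/-- **The lock from the RP core** (reshape 17): `stub_lockOfRpCore` applied to `stub_rpCore` (fed with the three
geometric glue statements), under `XiDiverges` and the crux's hypothesis at `r`. [folklore] -/
theorem locked_of_core (hXi : DirichletWindow.XiDiverges) (hG : IsCompactSimpleLieGroup G) (r : LatticeRep G)
    (hGap : GapHypAt r) : ∃ (β : ℕ → ℝ) (mh : ℕ → ℝ) (S₁ : ℕ → ℕ) (K : ℝ), LockedAlong r β mh S₁ K := by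
  obtain ⟨β, mh, S₁, K, h1, h2, h3, h4, h5⟩ := stub_lockOfRpCore hXi G hG r hGap
    (stub_rpCore G r (stub_rpFormsCS G r) (stub_rpShift G r) (stub_obsGeometry G r))
  exact ⟨β, mh, S₁, K, h1, h2, h3, h4, h5⟩

/-- (GAP) for the UV-built scheme is bookkeeping: the UNIFORM constants transported along `φ`, the thresholds below
`L_k`, the unit `Δ₀ a_k ≤ m̂_{φ k}` (landed `hasLatticeMassGap_of_uniformClustering`). [folklore] -/
theorem gap_of_locked (r : LatticeRep G) {β : ℕ → ℝ} {mh : ℕ → ℝ} {S₁ : ℕ → ℕ} {K : ℝ}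
    (hL : LockedAlong r β mh S₁ K) {sch : SpeciesScheme (YMSpecies G)} {φ : ℕ → ℕ} {Δ₀ : ℝ}
    (hβ : ∀ k, sch.β k = β (φ k)) (ha : ∀ k, Δ₀ * sch.a k ≤ mh (φ k))
    (hLk : ∀ k, S₁ (φ k) ≤ sch.L k) : HasLatticeMassGap r sch Δ₀ := by
  refine hasLatticeMassGap_of_uniformClustering r sch Δ₀ (fun k => mh (φ k)) (Eventually.of_forall ha) fun A B => ?_
  obtain ⟨C, hC⟩ := hL.2.2.2.1 A B
  refine ⟨C, Eventually.of_forall fun k S hS n hn => ?_⟩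
  rw [hβ k]
  exact hC (φ k) S n ((hLk k).trans hS) hn

/-- The lattice gap is monotone in the rate. [folklore] -/
theorem hasLatticeMassGap_mono (r : LatticeRep G) (sch : SpeciesScheme (YMSpecies G)) {Δ Δ' : ℝ}
    (hΔ : Δ' ≤ Δ) (h : HasLatticeMassGap r sch Δ) : HasLatticeMassGap r sch Δ' := by
  intro A B
  obtain ⟨C, hC⟩ := h A B
  refine ⟨max C 0, hC.mono fun k hk S hS n hn => (hk S hS n hn).trans ?_⟩
  have h1 : Real.exp (-(Δ * (sch.a k * n))) ≤ Real.exp (-(Δ' * (sch.a k * n))) :=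
    Real.exp_le_exp.2 (neg_le_neg (mul_le_mul_of_nonneg_right hΔ
      (mul_nonneg (sch.a_pos k).le (Nat.cast_nonneg n))))
  calc C * Real.exp (-(Δ * (sch.a k * n))) ≤ max C 0 * Real.exp (-(Δ * (sch.a k * n))) :=
        mul_le_mul_of_nonneg_right (le_max_left _ _) (Real.exp_pos _).le
    _ ≤ max C 0 * Real.exp (-(Δ' * (sch.a k * n))) := mul_le_mul_of_nonneg_left h1 (le_max_right _ _)

/-! ### §3.3 The card: the skewness floor, frequently -/

/-- **The card's first lemma, subsequential form** (from the LANDED `stub_witness`, p121579). [folklore] -/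
theorem ng_of_skewWindow (r : LatticeRep G) (sch : SpeciesScheme (YMSpecies G)) (h : SkewWindow r sch) :
    NG r sch := by
  obtain ⟨s₃, φ, f, g, h, F₃, w, hs₃, hφ, hw, hF, hwin⟩ := h
  obtain ⟨f₀, g₀, h₀, F₀, hT, hO, δ, hδ, hfreq⟩ :=
    Summit.QuantumFields.YangMills.Theorems.ContinuumLegGivenGap.stub_witness
      (fun k F => LSk r sch (φ k) 3 F) ⟨s₃, f, g, h, F₃, w, hs₃, hw, hF, hwin⟩
  exact ⟨f₀, g₀, h₀, F₀, hT, hO, δ, hδ, hφ.tendsto_atTop.frequently hfreq⟩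

/-- (UVB) from (CAN) ∧ (VS) ∧ (UUVB) (landed `stub_uvb`, p125690). [folklore] -/
theorem uvb_of_uuvb (r : LatticeRep G) (sch : SpeciesScheme (YMSpecies G))
    (hCAN : CAN r sch) (hVS : VS r sch) (hUUVB : UUVB r sch) : UVB r sch :=
  Summit.QuantumFields.YangMills.Theorems.ContinuumLegGivenGap.stub_uvb G r sch (LSk r sch) (fun _ _ _ => rfl)
    hCAN hVS hUUVB

/-- (EUC) from (PVG) ∧ (CAN) ∧ (VS) ∧ (UUVB): route ParabolicTrajectory's landed `stub_transl : TranslOfUUVB`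
(exact torus translations + seam relocation + UUVB on the sub-lattice remainder), read back on `LSk = curvDistribution`.
[folklore] -/
theorem euc_of_pvg (r : LatticeRep G) (sch : SpeciesScheme (YMSpecies G)) (hPVG : PVG sch) (hCAN : CAN r sch)
    (hVS : VS r sch) (hUUVB : UUVB r sch) : EUC r sch := by
  intro n F hF a
  have h := Summit.QuantumFields.YangMills.Cruxes.ContinuumLimitOnTrajectory.TwoOrbitSynchronisation.stub_transl G r sch
    hPVG (uuvb_of_unfolded r sch hUUVB) n F hF a
  refine h.congr fun k => ?_
  simp only [lsk_eq_curvDistribution r sch (LSk r sch) (fun _ _ _ => rfl) hCAN hVS]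

/-- (NG) for any weak-coupling scheme pinned by (VS), (UVB), (ND), (CL-t): the card's window + its first lemma.
[folklore] -/
theorem ng_of_pinned (hG : IsCompactSimpleLieGroup G) (r : LatticeRep G) (sch : SpeciesScheme (YMSpecies G))
    (hAF : Tendsto sch.β atTop atTop) (hVS : VS r sch) (hUVB : UVB r sch) (hND : ND r sch) (hCLt : CLt r sch) :
    NG r sch :=
  ng_of_skewWindow r sch (stub_skewWindow G hG r sch (LSk r sch) (fun _ _ _ => rfl) hAF hVS hUVB hND hCLt)

/-! ### §3.4 The proved dock: route ParabolicTrajectory's one-field currency -/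

/-- With (CAN) ∧ (VS), `LSk` IS `curvDistribution` (landed `lsk_eq_curvDistribution`). [folklore] -/
theorem lsk_eq (r : LatticeRep G) (sch : SpeciesScheme (YMSpecies G)) (hCAN : CAN r sch) (hVS : VS r sch)
    (k n : ℕ) (F : 𝓢((Fin n → EuclideanSpace ℝ (Fin 4)), ℂ)) : LSk r sch k n F = curvDistribution r sch k n F :=
  lsk_eq_curvDistribution r sch (LSk r sch) (fun _ _ _ => rfl) hCAN hVS k n F

/-- `curvDistribution` of a sub-scheme is `curvDistribution` along the subsequence (definitional). [folklore] -/
theorem curvDistribution_subScheme (r : LatticeRep G) (sch : SpeciesScheme (YMSpecies G)) (ψ : ℕ → ℕ)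
    (hψ : StrictMono ψ) (k n : ℕ) (F : 𝓢((Fin n → EuclideanSpace ℝ (Fin 4)), ℂ)) :
    curvDistribution r (subScheme sch ψ hψ) k n F = curvDistribution r sch (ψ k) n F :=
  rfl

/-- The lattice Schwinger functions of the canonical scheme of a sub-scheme are those of the canonical scheme along
the subsequence (definitional). [folklore] -/
theorem latticeSchwinger_canon_subScheme (r : LatticeRep G) (sch : SpeciesScheme (YMSpecies G)) (ψ : ℕ → ℕ)
    (hψ : StrictMono ψ) (k n : ℕ) (σ : Fin n → YMSpecies G) (f : Fin n → 𝓢(EuclideanSpace ℝ (Fin 4), ℝ)) :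
    latticeSchwinger r.ρ (canon r (subScheme sch ψ hψ)) (fun s => s.F) k n σ f =
      latticeSchwinger r.ρ (canon r sch) (fun s => s.F) (ψ k) n σ f :=
  rfl

/-- (CSCL) rides along subsequences (every clause of `ClustersCS` is `∀ᶠ k`). [folklore] -/
theorem hasCSClustering_canon_subScheme (r : LatticeRep G) (sch : SpeciesScheme (YMSpecies G)) (ψ : ℕ → ℕ)
    (hψ : StrictMono ψ) {Δ : ℝ} (h : SpeciesScheme.HasCSClustering r (canon r sch) Δ) :
    SpeciesScheme.HasCSClustering r (canon r (subScheme sch ψ hψ)) Δ := by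
  intro n m hn hm σ σ' N N' c c' p q hp hq t ht ε hε
  exact hψ.tendsto_atTop.eventually (h n m hn hm σ σ' N N' c c' p q hp hq t ht ε hε)

/-- (CSCL) is monotone in the rate (`e^{-Δt} ≤ e^{-Δ't}` for `Δ' ≤ Δ`, `t ≥ 0`). [folklore] -/
theorem hasCSClustering_mono (r : LatticeRep G) (sch : SpeciesScheme (YMSpecies G)) {Δ Δ' : ℝ} (hΔ : Δ' ≤ Δ)
    (h : SpeciesScheme.HasCSClustering r sch Δ) : SpeciesScheme.HasCSClustering r sch Δ' := by
  intro n m hn hm σ σ' N N' c c' p q hp hq t ht ε hε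
  refine (h n m hn hm σ σ' N N' c c' p q hp hq t ht ε hε).mono fun k hk => hk.trans ?_
  have h1 : Real.exp (-Δ * t) ≤ Real.exp (-Δ' * t) := Real.exp_le_exp.2 (by nlinarith)
  gcongr

/-- The lattice gap of the canonical scheme is that of the scheme (same `a, β, L`; definitional). [folklore] -/
theorem hasLatticeMassGap_canon_iff (r : LatticeRep G) (sch : SpeciesScheme (YMSpecies G)) (Δ : ℝ) :
    HasLatticeMassGap r (canon r sch) Δ ↔ HasLatticeMassGap r sch Δ :=
  Iff.rfl

/-- **Conversion of the UV package to route ParabolicTrajectory's currency along a sub-scheme.** For a canonically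
normalised, exactly centred scheme and ANY strictly increasing `ψ`: (UUVB) gives PT's `UVB` and `ARP` for
`subScheme sch ψ` (landed `uvb_of_uuvb`, `stub_arp`, `torusSlabRP_of_tendsto`); (ND) gives `ND2`; (UCL) gives `UCL`;
(EUC) ∧ (ROT) give `AsympEuclid` — all by `LSk = curvDistribution` and `∀ᶠ` along `ψ → ∞`. [folklore] -/
theorem pt_package_subScheme (r : LatticeRep G) (sch : SpeciesScheme (YMSpecies G)) (hAF : Tendsto sch.β atTop atTop)
    (hCAN : CAN r sch) (hVS : VS r sch) (hUUVB : UUVB r sch) (hND : ND r sch) (hUCL : UCL r sch) (hEUC : EUC r sch)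
    (hROT : ROT r sch) (ψ : ℕ → ℕ) (hψ : StrictMono ψ) :
    PT_UVB r (subScheme sch ψ hψ) ∧ PT_ARP r (subScheme sch ψ hψ) ∧ ND2 r (subScheme sch ψ hψ) ∧
      UCL r (subScheme sch ψ hψ) ∧ AsympEuclid r (subScheme sch ψ hψ) := by
  have hlsk := lsk_eq r sch hCAN hVS
  -- PT's UUVB for the sub-scheme: the unfolded clause along ψ
  have hUU2 : PT_UUVB r (subScheme sch ψ hψ) := by
    obtain ⟨s, α, β', h⟩ := hUUVB
    refine uuvb_of_unfolded r (subScheme sch ψ hψ) ⟨s, α, β', ?_⟩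
    exact hψ.tendsto_atTop.eventually h
  have hUVB2 : PT_UVB r (subScheme sch ψ hψ) :=
    Summit.QuantumFields.YangMills.Cruxes.ContinuumLimitOnTrajectory.TwoOrbitSynchronisation.uvb_of_uuvb r _ hUU2
  have hAF2 : Tendsto (subScheme sch ψ hψ).β atTop atTop := hAF.comp hψ.tendsto_atTop
  have hARP2 : PT_ARP r (subScheme sch ψ hψ) :=
    Summit.QuantumFields.YangMills.Cruxes.ContinuumLimitOnTrajectory.TwoOrbitSynchronisation.stub_arp G r _
      (torusSlabRP_of_tendsto r _ hAF2) hUU2 hUVB2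
  refine ⟨hUVB2, hARP2, ?_, ?_, ?_, ?_⟩
  · -- ND2
    obtain ⟨f, g, H, hf, hg, hH, δ, hδ, hev⟩ := hND
    refine ⟨f, g, H, hf, hg, hH, δ, hδ, ?_⟩
    refine (hψ.tendsto_atTop.eventually hev).mono fun k hk => ?_
    rw [curvDistribution_subScheme, ← hlsk]
    exact hk
  · -- UCL (rides along `ψ`: every clause is `∀ᶠ k`)
    intro n m F G' hF hG' a ha0 ha ε hε
    obtain ⟨t₀, ht₀⟩ := hUCL n m F G' hF hG' a ha0 ha ε hε
    refine ⟨t₀, fun t ht H hH => ?_⟩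
    exact hψ.tendsto_atTop.eventually (ht₀ t ht H hH)
  · -- AsympEuclid, translation half
    intro p F hF a
    have h := (hEUC p F hF a).comp hψ.tendsto_atTop
    refine h.congr fun k => ?_
    simp only [Function.comp_apply, curvDistribution_subScheme, hlsk]
  · -- AsympEuclid, rotation half
    intro p F hF R hR
    have h := (hROT p F hF R hR).comp hψ.tendsto_atTop
    refine h.congr fun k => ?_
    simp only [Function.comp_apply, curvDistribution_subScheme, hlsk]

/-! ### §3.5 The skeleton -/

/-- **`ContinuumLegGivenGap_of`** — the line's skeleton (reshape 12): `XiDiverges` (stmt-8941) BY NAME implies the crux;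
every other ingredient is a registered stub or a landed theorem. See the module docstring for the composition.
[folklore] -/
theorem ContinuumLegGivenGap_of (hXi : DirichletWindow.XiDiverges) : ConvexGribovBody.ContinuumLegGivenGap := by
  intro G _ _ _ _ hG
  letI : MeasurableSpace G := borel G
  haveI : BorelSpace G := ⟨rfl⟩
  intro hGap
  obtain ⟨r, huv⟩ := uvPackage_exists hG
  obtain ⟨β, mh, S₁, K, hL⟩ := locked_of_core hXi hG r (hGap r)
  have hcrit : Tendsto mh atTop (𝓝 0) :=
    Summit.QuantumFields.YangMills.Theorems.ContinuumLegGivenGap.stub_critical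
      hXi G hG r (hGap r) β mh S₁ hL.1 hL.2.1 hL.2.2.2.1
  obtain ⟨sch, φ, Δ₀, hφ, hβ, hΔ₀, ha, hLk, hVS, hCAN, hUUVB, hND, hCLt, hUCL, hPVG, hROT, Δ₁, hΔ₁, hCS⟩ :=
    huv hL hcrit
  have hEUC : EUC r sch := euc_of_pvg r sch hPVG hCAN hVS hUUVB
  have hAF : Tendsto sch.β atTop atTop := by
    have hcomp : sch.β = fun k => β (φ k) := funext hβ
    rw [hcomp]
    exact hL.1.comp hφ.tendsto_atTop
  have hUVB : UVB r sch := uvb_of_uuvb r sch hCAN hVS hUUVB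
  have hGAP : HasLatticeMassGap r sch Δ₀ := gap_of_locked r hL hβ ha hLk
  -- the card: skewness floor frequently; extract a sub-scheme inside that set with convergent products
  obtain ⟨f₃, g₃, h₃, F₃, hT₃, hO₃, δ, hδ, hfreq⟩ := ng_of_pinned hG r sch hAF hVS hUVB hND hCLt
  obtain ⟨ψ, hψ, hψS, hconv⟩ :=
    extract G r sch hUUVB {k | δ ≤ ‖LSk r sch k 3 F₃‖} hfreq
  set sch₂ : SpeciesScheme (YMSpecies G) := subScheme sch ψ hψ with hsch₂
  obtain ⟨hUVB2, hARP2, hND2, hUCL2, hE1⟩ := pt_package_subScheme r sch hAF hCAN hVS hUUVB hND hUCL hEUC hROT ψ hψ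
  have hND3 : ND3 r sch₂ := by
    refine ⟨f₃, g₃, h₃, F₃, hT₃, hO₃, δ, hδ, Eventually.of_forall fun k => ?_⟩
    rw [hsch₂, curvDistribution_subScheme, ← lsk_eq r sch hCAN hVS]
    exact hψS k
  -- the proved one-field OS packaging
  obtain ⟨T, hYM, hNT, hNGT⟩ := oneFieldOSLegs' G r sch₂ hconv hUVB2 hE1 hARP2 hUCL2 hND2 hND3
  -- the two gaps at the common rate
  set Δ : ℝ := min Δ₀ Δ₁ with hΔdef
  have hΔ : 0 < Δ := lt_min hΔ₀ hΔ₁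
  have hLG : HasLatticeMassGap r (canon r sch₂) Δ :=
    (hasLatticeMassGap_canon_iff r sch₂ Δ).2
      (hasLatticeMassGap_mono r sch₂ (min_le_left _ _) (hasLatticeMassGap_subScheme hGAP ψ hψ))
  have hCS2 : SpeciesScheme.HasCSClustering r (canon r sch₂) Δ :=
    hasCSClustering_mono r _ (min_le_right _ _) (hasCSClustering_canon_subScheme r sch ψ hψ hCS)
  have hMG : T.HasMassGap Δ := hYM.hasMassGap_of_hasCSClustering hCS2
  refine ⟨r, canon r sch₂, T, ?_, hYM, hNT, hNGT, Δ, hΔ, hMG, hLG⟩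
  show Tendsto (canon r sch₂).β atTop atTop
  exact hAF.comp hψ.tendsto_atTop

/-- The shared item's other declarations follow verbatim. [folklore] -/
theorem SmallCircleAnchor_ContinuumLegGivenGap_of (hXi : DirichletWindow.XiDiverges) :
    SmallCircleAnchor.ContinuumLegGivenGap :=
  smallCircleAnchor_iff.2 (ContinuumLegGivenGap_of hXi)

/-- (ditto) [folklore] -/
theorem HyperbolicRegulator_ContinuumLegGivenGap_of (hXi : DirichletWindow.XiDiverges) :
    HyperbolicRegulator.ContinuumLegGivenGap :=
  hyperbolicRegulator_iff.2 (ContinuumLegGivenGap_of hXi)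

/-- (ditto) [folklore] -/
theorem ContractibleFibre_WeakCouplingContinuumLeg_of (hXi : DirichletWindow.XiDiverges) :
    ContractibleFibre.WeakCouplingContinuumLeg :=
  contractibleFibre_iff.2 (ContinuumLegGivenGap_of hXi)

/-! ## §4 Position in the web (for the record) -/

/-- **The card's window and the skewness floor are EQUIVALENT under (UVB)** (landed `stub_witness` p121579 and
`stub_windowOfNG` p125188): the registered `stub_skewWindow` is stmt-9118 with (CL) ↦ (CL-t) and AF. [folklore] -/
theorem skewWindow_iff_ng (r : LatticeRep G) (sch : SpeciesScheme (YMSpecies G)) (hUVB : UVB r sch) :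
    SkewWindow r sch ↔ NG r sch :=
  ⟨ng_of_skewWindow r sch, fun hNG =>
    Summit.QuantumFields.YangMills.Theorems.ContinuumLegGivenGap.stub_windowOfNG (LSk r sch) hUVB hNG⟩

/-- `YangMills ⇒ crux` (discard the hypothesis; landed `continuumLegGivenGap_of_yangMills`). [folklore] -/
theorem crux_of_yangMills (h : YangMills) : ConvexGribovBody.ContinuumLegGivenGap :=
  Summit.QuantumFields.YangMills.Theorems.ContinuumLegGivenGap.continuumLegGivenGap_of_yangMills h

end Summit.QuantumFields.YangMills.Cruxes.ContinuumLegGivenGap.Sketch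

end
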